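import Literature.Analysis.FluidPDE.Tao2016AveragedNS.GateRetuning
import HarnessLib

/-!
# Tao 2016, Theorem 5.3 for the retuned gate `delayCircuitWith K M ε`, uniformly in the sharpness `M`

T. Tao, *Finite time blowup for an averaged three-dimensional Navier–Stokes equation*, J. Amer.
Math. Soc. **29** (2016) 601–674 = arXiv:1402.0290, §5.5, Theorem 5.3 and its proof (pp. 28–30 of
the arXiv version). [`Tao2016AveragedNS`]

HONEST FRAMING (cell pub-fluidc): part of a low prior, high value-of-information experiment on
Tao's machine paradigm; NOT a claim that NS blows up. This file is the blueprint seat's answer to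
the question left open by `GateRetuning.lean` (§F there, "what remains"): Tao's delay gate uses the
doubly-exponential seed `ε²e^{-K¹⁰}` and the amplifier `ε⁻¹K¹⁰`; `GateRetuning.lean` introduced the
one-parameter family `delayCircuitWith K M ε` (seed `ε²e^{-M}`, amplifier `ε⁻¹M`; Tao's (5.5) is
the member `M = K¹⁰`, `delayCircuitWith_pow_ten`) and proved only CARICATURE-level statements about
it (swept trigger, ignition time `√2` for every `M`). Here the whole printed bootstrap proof of
Theorem 5.3 is re-run for the family, UNIFORMLY in `3000·log K ≤ M ≤ K¹⁰`: the delayed abrupt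
energy transition survives with the same accuracy `O(K⁻¹⁰)`, the same abruptness `1/√K` on the
output side, a critical time `t_c = √2 + O(log K / M)` and a rotor-onset delay `880·log K / M`
(Tao: `K⁻⁹`). In particular a POLYNOMIALLY small seed `ε²K^{-p}` (`M = p log K`, `p ≥ 3000`)
suffices for Theorem 5.3's conclusion with window `O(1/p) + 1/√K`; the price of de-sharpening the
trigger is only the logarithmic loss in the location/width of the transition, not its existence.
(`M ≤ K¹⁰` is kept so that every absorption of the printed proof goes through verbatim; the lower
bound `M ≳ log K` is forced: the onset delay `880 log K / M` plus `1/√K` must fit before `t = 2`.)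

## What is proved (sorry-free)
* `Thm53With.tc_window` — (tcable)/(c-bound) for the family: the first hitting time `t_c` of the
  trigger level `K⁻¹⁰ε²` satisfies `2 - 24 log K / M ≤ t_c² ≤ 2 + 2/M` (needs `48 log K ≤ M ≤ K¹⁰`).
* `Thm53With.c_large` — (c-large) with onset delay `δ`, `K¹¹⁰ ≤ e^{Mδ/8}` (e.g. `δ = 880 log K/M`).
* `DelayedAbruptTransitionWith` / `delayedAbruptTransitionWith_holds` — Theorem 5.3 for
  `delayCircuitWith K M ε`, uniformly in `3000 log K ≤ M ≤ K¹⁰`, with `C = 3000`,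
  `K₀ = 2·20⁴²·42! + 16`, `ε₁(K,M) = e^{-10M}/K¹⁰⁰`: quiet (`a = 1 + O(K⁻¹⁰)`, rest `O(K⁻¹⁰)`) on
  `[0, t_c]`, fired (`ã = 1 + O(K⁻¹⁰)`, rest `O(K⁻¹⁰)`) for `t ≥ t_c + C log K / M + 1/√K`,
  `|t_c - √2| ≤ C log K / M`.
* `transitionWith_explicit` — the same with the sharper internal constants (`|t_c - √2| ≤
  24 log K / M`, levels `200K⁻¹⁰`, fired from `t_c + 880 log K / M + 1/√K`).
* `polySeedTransition` (with `delayCircuitWith_log`, `exp_neg_natMul_log`) — the member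
  `M = p log K`, i.e. the POLYNOMIAL seed `ε²K⁻ᵖ` and amplifier `ε⁻¹p log K`: for `p ≥ 3000`,
  `K ≥ K₀`, `p ≤ K⁹`, `0 < ε ≤ K^{-(10p+100)}` the transition is quiet on `[0,t_c]` with
  `|t_c - √2| ≤ 24/p` and complete from `t_c + 880/p + 1/√K` on — every threshold a POWER of `K`.
* `internalTimescalesWith` — the spec-sheet quantities (trigger level, onset `t_c + 880 log K/M`,
  `ã ≥ 1/10` at onset `+ 1/K`, residual `≤ 143K⁻²⁰` from onset `+ 1/√K`) for every trajectory.
* `delayedAbruptTransition_of_with` — consistency: the member `M = K¹⁰` re-proves the named fact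
  `DelayedAbruptTransition` of `DelayCircuit.lean` (a second, independent discharge).

## Architecture (pp. 28–30; identical to `DelayCircuitHolds.lean`, whose toolkit is reused by name)
Modes `(a,b,c,d,ã) = (X 0, X 1, X 2, X 3, X 4)`; couplings `μ = ε²e^{-M}`, `ν = ε⁻¹M`, `ρ = ε⁻²`,
`K`. The port replaces `K¹⁰` by `M` exactly where it is a COUPLING (`μ`, `ν`, the comparison
exponents `Mt²/2`, the crude rate `5M`, the growth rate `M/8`) and keeps every LEVEL / accuracy
power of `K` (`K⁻¹⁰ε²`, `3K⁻¹⁰`, `8K⁻²⁰`, `17εK⁻²⁰`, `K¹⁰⁰ε²`, `9K⁻⁹⁰`, `143K⁻²⁰`) as printed.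
* (ob-2) `bc_small`; `c_nonneg`; (code) `c_crude` (`c ≤ 2ε²e^{(5t-1)M}`); (dora) `de_small`;
  (able2) `a_near_one`; (bogo-2) `b_linear` (uses `Mε² ≤ 1`); sharp comparison `c_upper_sharp`,
  `c_lower_sharp` (`β = 34M K⁻²⁰ ≤ ½`, `M K⁻¹⁰ ≤ 1` on `[0,K⁻⁵]`); (tcable) `tc_window` — here the
  window is read off DIRECTLY from the hitting condition with `Real.log` (no `K⁹` numerics).
* after `t_c`: `b_lower_after` (`ε²e^{18M} ≤ 1/(64M)`), `c_growth` (rate `M/8`), (c-large)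
  `c_large` on `[t_c + δ, 2]` for any onset delay with `K¹¹⁰ ≤ e^{Mδ/8}`, (cgrow-2)
  `c_deriv_bounds` (`∂ₜc ≤ 6K¹⁰c`, using `M ≤ K¹⁰`).
* equipartition verbatim with `σ = t_c + δ` in place of `t_c + K⁻⁹`: `hasDerivAt_V`,
  `V_remainder_le`, (atc) `e_tenth` (`ã(σ + 1/K) ≥ 1/10`), `hasDerivAt_Es`, `Es_dissipation`,
  `Es_decay`, `ad_small_late`, `late_sum_sq`, `beable_of_sum_sq`, `able_window`; thresholds
  `eps_facts` (`ε₁ = e^{-10M}/K¹⁰⁰`), `Thm53.numeric_N4`; assembly.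
Reused by name from `DelayCircuitHolds.lean` (namespace `Thm53`, trajectory-free lemmas): the
integrating-factor toolkit, `exists_hitTime`, `abs_sub_le_of_abs_deriv_le`, `invSqrt_facts`,
`sqrt_two_gt/lt`, `Es_alg`, `decay_alg`, `numeric_N4`.

## References
* T. Tao, JAMS 29 (2016) 601–674, arXiv:1402.0290, §5.5 Theorem 5.3 and proof. [`Tao2016AveragedNS`]
-/

noncomputable section

namespace Literature.Analysis.FluidPDE.Tao2016AveragedNS

open Set Real Filter
open _root_.Topology

/-! ## Local energy identities of the family (as for (5.5)) -/

/-- `∂ₜ(b² + c²) = 2εa²b + 2ε²e^{-M}a²c` along `delayCircuitWith K M ε` — the amplifier cancels.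
[cite: Tao2016AveragedNS, §5.5 proof (ob-2)] -/
theorem delayCircuitWith_bc_energy {K M ε : ℝ} {X : ℝ → Fin 5 → ℝ} {t : ℝ}
    (hX : HasDerivAt X (delayCircuitWith K M ε (X t)) t) :
    HasDerivAt (fun s => X s 1 ^ 2 + X s 2 ^ 2)
      (2 * ε * X t 0 ^ 2 * X t 1 + 2 * ε ^ 2 * Real.exp (-M) * X t 0 ^ 2 * X t 2) t := by
  refine (((hasDerivAt_pi.1 hX 1).fun_pow 2).fun_add ((hasDerivAt_pi.1 hX 2).fun_pow 2)).congr_deriv ?_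
  simp only [show (2 : ℕ) - 1 = 1 from rfl, pow_one, Nat.cast_ofNat, delayCircuitWith, Fin.isValue,
    Matrix.cons_val_one, Matrix.cons_val_two, Matrix.cons_val_zero, Matrix.head_cons,
    Matrix.tail_cons]
  ring

/-- `∂ₜ(d² + ã²) = 2ε⁻²c·a·d` along `delayCircuitWith K M ε` — the drain cancels.
[cite: Tao2016AveragedNS, §5.5 proof (dora)] -/
theorem delayCircuitWith_out_energy {K M ε : ℝ} {X : ℝ → Fin 5 → ℝ} {t : ℝ}
    (hX : HasDerivAt X (delayCircuitWith K M ε (X t)) t) :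
    HasDerivAt (fun s => X s 3 ^ 2 + X s 4 ^ 2)
      (2 * (ε ^ 2)⁻¹ * X t 2 * X t 0 * X t 3) t := by
  refine (((hasDerivAt_pi.1 hX 3).fun_pow 2).fun_add ((hasDerivAt_pi.1 hX 4).fun_pow 2)).congr_deriv ?_
  simp only [show (2 : ℕ) - 1 = 1 from rfl, pow_one, Nat.cast_ofNat, delayCircuitWith, Fin.isValue,
    Matrix.cons_val]
  ring

/-- The output `ã` is non-decreasing along every trajectory of the family (`∂ₜã = Kd² ≥ 0`).
[cite: Tao2016AveragedNS, §5.5 (ta-eq)] -/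
theorem delayCircuitWith_output_monotone {K M ε : ℝ} (hK : 0 ≤ K) {X : ℝ → Fin 5 → ℝ}
    (hX : ∀ t, HasDerivAt X (delayCircuitWith K M ε (X t)) t) : Monotone fun t => X t 4 := by
  have hd : ∀ t, HasDerivAt (fun s => X s 4) (K * X t 3 ^ 2) t := fun t => by
    simpa [delayCircuitWith] using hasDerivAt_pi.1 (hX t) 4
  refine monotone_of_deriv_nonneg (fun t => (hd t).differentiableAt) fun t => ?_
  rw [(hd t).deriv]
  positivity

namespace Thm53With

open Thm53 (antitoneOn_intFactor monotoneOn_intFactor antitoneOn_sub_of_deriv_le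
  monotoneOn_sub_of_le_deriv exists_hitTime abs_sub_le_of_abs_deriv_le sqrt_two_gt sqrt_two_lt
  invSqrt_facts Es_alg decay_alg numeric_N4 init_a init_b init_c init_d init_e)
open DelayWith (hasDerivAt_e)

/-! ## The trajectory: components, energy, signs -/

section Trajectory

variable {K M ε : ℝ} {X : ℝ → Fin 5 → ℝ}

/-- Each mode of a trajectory is continuous. [folklore] -/
theorem continuous_traj (hX : ∀ t, HasDerivAt X (delayCircuitWith K M ε (X t)) t) (i : Fin 5) :
    Continuous fun s => X s i :=
  (continuous_apply i).comp (continuous_iff_continuousAt.2 fun t => (hX t).continuousAt)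

/-- (a-eq): `∂ₜa = -ε⁻²cd - εab - ε²e^{-K¹⁰}ac`. [cite: Tao2016AveragedNS, §5.5 (5.5)] -/
theorem hasDerivAt_a (hX : ∀ t, HasDerivAt X (delayCircuitWith K M ε (X t)) t) (t : ℝ) :
    HasDerivAt (fun s => X s 0)
      (-((ε ^ 2)⁻¹ * X t 2 * X t 3) - ε * X t 0 * X t 1
        - ε ^ 2 * exp (-M) * X t 0 * X t 2) t :=
  (hasDerivAt_pi.1 (hX t) 0).congr_deriv (by simp [delayCircuitWith])

/-- (b-eq): `∂ₜb = εa² - ε⁻¹K¹⁰c²`. [cite: Tao2016AveragedNS, §5.5 (5.5)] -/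
theorem hasDerivAt_b (hX : ∀ t, HasDerivAt X (delayCircuitWith K M ε (X t)) t) (t : ℝ) :
    HasDerivAt (fun s => X s 1) (ε * X t 0 ^ 2 - ε⁻¹ * M * X t 2 ^ 2) t :=
  (hasDerivAt_pi.1 (hX t) 1).congr_deriv (by simp [delayCircuitWith])

/-- (c-eq): `∂ₜc = ε²e^{-K¹⁰}a² + ε⁻¹K¹⁰bc`. [cite: Tao2016AveragedNS, §5.5 (5.5)] -/
theorem hasDerivAt_c (hX : ∀ t, HasDerivAt X (delayCircuitWith K M ε (X t)) t) (t : ℝ) :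
    HasDerivAt (fun s => X s 2)
      (ε ^ 2 * exp (-M) * X t 0 ^ 2 + ε⁻¹ * M * X t 1 * X t 2) t :=
  (hasDerivAt_pi.1 (hX t) 2).congr_deriv (by simp [delayCircuitWith])

/-- (d-eq): `∂ₜd = ε⁻²ca - Kdã`. [cite: Tao2016AveragedNS, §5.5 (5.5)] -/
theorem hasDerivAt_d (hX : ∀ t, HasDerivAt X (delayCircuitWith K M ε (X t)) t) (t : ℝ) :
    HasDerivAt (fun s => X s 3) ((ε ^ 2)⁻¹ * X t 2 * X t 0 - K * X t 3 * X t 4) t :=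
  (hasDerivAt_pi.1 (hX t) 3).congr_deriv (by simp [delayCircuitWith])

/-- (energy-con) in components. [cite: Tao2016AveragedNS, §5.5 (energy-con)] -/
theorem traj_sum_sq_eq_one (hX : ∀ t, HasDerivAt X (delayCircuitWith K M ε (X t)) t)
    (h0 : X 0 = delayInit) (t : ℝ) :
    X t 0 ^ 2 + X t 1 ^ 2 + X t 2 ^ 2 + X t 3 ^ 2 + X t 4 ^ 2 = 1 := by
  have h := delayCircuitWith_energy_init hX h0 t
  simpa [energy, Fin.sum_univ_five] using h

/-- (est): every mode is `O(1)`. [cite: Tao2016AveragedNS, §5.5 (est)] -/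
theorem traj_sq_le_one (hX : ∀ t, HasDerivAt X (delayCircuitWith K M ε (X t)) t)
    (h0 : X 0 = delayInit) (t : ℝ) (i : Fin 5) : X t i ^ 2 ≤ 1 := by
  have h := delayCircuitWith_energy_init hX h0 t
  rw [energy] at h
  calc X t i ^ 2 ≤ ∑ j, X t j ^ 2 :=
        Finset.single_le_sum (f := fun j => X t j ^ 2) (fun j _ => sq_nonneg (X t j))
          (Finset.mem_univ i)
    _ = 1 := h

/-- (est): `|Xᵢ| ≤ 1`. [cite: Tao2016AveragedNS, §5.5 (est)] -/
theorem traj_abs_le_one (hX : ∀ t, HasDerivAt X (delayCircuitWith K M ε (X t)) t)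
    (h0 : X 0 = delayInit) (t : ℝ) (i : Fin 5) : |X t i| ≤ 1 :=
  sq_le_one_iff_abs_le_one _ |>.1 (traj_sq_le_one hX h0 t i)

/-- `ã ≥ 0` for `t ≥ 0` (it is non-decreasing from `0`). [cite: Tao2016AveragedNS, §5.5 proof] -/
theorem e_nonneg (hX : ∀ t, HasDerivAt X (delayCircuitWith K M ε (X t)) t) (h0 : X 0 = delayInit)
    (hK : 0 ≤ K) {t : ℝ} (ht : 0 ≤ t) : 0 ≤ X t 4 := by
  have := delayCircuitWith_output_monotone hK hX ht
  simpa [init_e h0] using this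

/-! ## (ob-2): `b, c = O(ε)` on `[0,2]` -/

/-- (ob-2), quantitatively: `|b|, |c| ≤ 5ε` on `[0,2]`, from the local energy identity
`∂ₜ(b²+c²) = 2εa²b + 2μa²c` applied to `√(b²+c²+ε²)`. [cite: Tao2016AveragedNS, §5.5 (ob-2)] -/
theorem bc_small (hX : ∀ t, HasDerivAt X (delayCircuitWith K M ε (X t)) t) (h0 : X 0 = delayInit)
    (hε : 0 < ε) (hε1 : ε ≤ 1) (hM0 : 0 ≤ M) {t : ℝ} (ht : t ∈ Icc 0 2) :
    |X t 1| ≤ 5 * ε ∧ |X t 2| ≤ 5 * ε := by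
  set f : ℝ → ℝ := fun s => X s 1 ^ 2 + X s 2 ^ 2 with hf
  set h : ℝ → ℝ := fun s => sqrt (f s + ε ^ 2) with hh
  have hfpos : ∀ s, 0 < f s + ε ^ 2 := fun s => by positivity
  have hb_le : ∀ s, |X s 1| ≤ h s := fun s =>
    abs_le_sqrt (by simp only [hf]; nlinarith [sq_nonneg (X s 2)])
  have hc_le : ∀ s, |X s 2| ≤ h s := fun s =>
    abs_le_sqrt (by simp only [hf]; nlinarith [sq_nonneg (X s 1)])
  have hder : ∀ s, HasDerivAt h
      ((2 * ε * X s 0 ^ 2 * X s 1 + 2 * ε ^ 2 * exp (-M) * X s 0 ^ 2 * X s 2)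
        / (2 * sqrt (f s + ε ^ 2))) s := fun s =>
    ((delayCircuitWith_bc_energy (hX s)).add_const (ε ^ 2)).sqrt (hfpos s).ne'
  have hbound : ∀ s, (2 * ε * X s 0 ^ 2 * X s 1 + 2 * ε ^ 2 * exp (-M) * X s 0 ^ 2 * X s 2)
        / (2 * sqrt (f s + ε ^ 2)) ≤ 2 * ε := by
    intro s
    have hhpos : 0 < sqrt (f s + ε ^ 2) := sqrt_pos.2 (hfpos s)
    rw [div_le_iff₀ (by positivity)]
    have ha : X s 0 ^ 2 ≤ 1 := traj_sq_le_one hX h0 s 0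
    have ha0 : 0 ≤ X s 0 ^ 2 := sq_nonneg _
    have hek : exp (-M) ≤ 1 := by rw [exp_le_one_iff, neg_nonpos]; exact hM0
    have hbs : |X s 1| ≤ h s := hb_le s
    have hcs : |X s 2| ≤ h s := hc_le s
    have hb1 : X s 1 ≤ h s := (le_abs_self _).trans hbs
    have hc1 : X s 2 ≤ h s := (le_abs_self _).trans hcs
    have hc2 : -h s ≤ X s 2 := by have := neg_abs_le (X s 2); linarith
    have hh0 : 0 ≤ h s := (abs_nonneg _).trans hbs
    -- `a² b ≤ h`, `ε² e^{-k} a² c ≤ ε h`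
    have h1 : X s 0 ^ 2 * X s 1 ≤ h s := by nlinarith
    have h21 : ε ^ 2 * exp (-M) ≤ ε := by
      calc ε ^ 2 * exp (-M) ≤ ε ^ 2 * 1 :=
            mul_le_mul_of_nonneg_left hek (sq_nonneg _)
        _ = ε * ε := by ring
        _ ≤ ε * 1 := mul_le_mul_of_nonneg_left hε1 hε.le
        _ = ε := mul_one _
    have hεe : 0 ≤ ε ^ 2 * exp (-M) := by positivity
    have h22 : |X s 0 ^ 2 * X s 2| ≤ h s := by
      rw [abs_mul, abs_of_nonneg ha0]; nlinarith [abs_nonneg (X s 2)]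
    have h23 : ε ^ 2 * exp (-M) * (X s 0 ^ 2 * X s 2) ≤ ε * h s := by
      calc ε ^ 2 * exp (-M) * (X s 0 ^ 2 * X s 2)
          ≤ ε ^ 2 * exp (-M) * |X s 0 ^ 2 * X s 2| :=
            mul_le_mul_of_nonneg_left (le_abs_self _) hεe
        _ ≤ ε * h s := mul_le_mul h21 h22 (abs_nonneg _) hε.le
    have : h s = sqrt (f s + ε ^ 2) := rfl
    rw [← this]
    nlinarith
  -- `h - 2εt` is antitone on `[0,2]`
  have hanti := antitoneOn_sub_of_deriv_le (convex_Icc 0 2) (fun s _ => hder s)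
    (fun s _ => ((hasDerivAt_id s).const_mul (2 * ε))) (fun s _ => by simpa using hbound s)
  have h0mem : (0 : ℝ) ∈ Icc (0 : ℝ) 2 := ⟨le_rfl, by norm_num⟩
  have hmono := hanti h0mem ht ht.1
  have hh0 : h 0 = ε := by
    simp only [hh, hf, init_b h0, init_c h0]
    simpa using sqrt_sq hε.le
  simp only [hh0, id, mul_zero, sub_zero] at hmono
  have hht : h t ≤ 5 * ε := by
    have := ht.2
    nlinarith
  exact ⟨(hb_le t).trans hht, (hc_le t).trans hht⟩

/-! ## `c ≥ 0` and the crude Grönwall bound (code) -/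

/-- `c(t) ≥ 0` for `t ≥ 0` ("from the initial condition `c(0)=0` and a comparison argument"),
via the integrating factor `exp(-∫₀ᵗ ε⁻¹K¹⁰ b)`. [cite: Tao2016AveragedNS, §5.5 proof] -/
theorem c_nonneg (hX : ∀ t, HasDerivAt X (delayCircuitWith K M ε (X t)) t) (h0 : X 0 = delayInit)
    {t : ℝ} (ht : 0 ≤ t) : 0 ≤ X t 2 := by
  set G : ℝ → ℝ := fun s => ∫ r in (0 : ℝ)..s, ε⁻¹ * M * X r 1 with hG
  have hGd : ∀ s, HasDerivAt G (ε⁻¹ * M * X s 1) s := fun s =>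
    ((continuous_const.mul (continuous_traj hX 1)).integral_hasStrictDerivAt 0 s).hasDerivAt
  have hmono := monotoneOn_intFactor (s := univ) (φ := fun _ => 0) (Φ := fun _ => 0) convex_univ
    (fun s _ => hasDerivAt_c hX s) (fun s _ => hGd s) (fun s _ => hasDerivAt_const s (0 : ℝ))
    (fun s _ => by
      have : (ε ^ 2 * exp (-M) * X s 0 ^ 2 + ε⁻¹ * M * X s 1 * X s 2
          - ε⁻¹ * M * X s 1 * X s 2) * exp (-G s)
          = ε ^ 2 * exp (-M) * X s 0 ^ 2 * exp (-G s) := by ring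
      rw [this]; positivity)
  have h := hmono (mem_univ 0) (mem_univ t) ht
  simp only [init_c h0, zero_mul, sub_zero] at h
  exact (mul_nonneg_iff_of_pos_right (exp_pos (-G t))).1 h

/-- (code): the crude Grönwall bound `c(t) ≤ 2ε² e^{(5t-1)K¹⁰}` on `[0,2]` (from
`∂ₜc ≤ μ + 5K¹⁰ c`). [cite: Tao2016AveragedNS, §5.5 (code)] -/
theorem c_crude (hX : ∀ t, HasDerivAt X (delayCircuitWith K M ε (X t)) t) (h0 : X 0 = delayInit)
    (hε : 0 < ε) (hε1 : ε ≤ 1) (hM0 : 0 ≤ M) {t : ℝ} (ht : t ∈ Icc 0 2) :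
    X t 2 ≤ 2 * ε ^ 2 * exp ((5 * t - 1) * M) := by
  set μ := ε ^ 2 * exp (-M) with hμ
  have hμ0 : 0 ≤ μ := by positivity
  have hanti := antitoneOn_intFactor (s := Icc 0 2) (g := fun _ => 5 * M)
    (G := fun s => 5 * M * s) (φ := fun _ => μ) (Φ := fun s => μ * s) (convex_Icc 0 2)
    (fun s _ => hasDerivAt_c hX s)
    (fun s _ => ((hasDerivAt_id s).const_mul (5 * M)).congr_deriv (by simp))
    (fun s _ => ((hasDerivAt_id s).const_mul μ).congr_deriv (by simp))
    (fun s hs => by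
      have hc0 : 0 ≤ X s 2 := c_nonneg hX h0 hs.1
      have hb : |X s 1| ≤ 5 * ε := (bc_small hX h0 hε hε1 hM0 hs).1
      have ha : X s 0 ^ 2 ≤ 1 := traj_sq_le_one hX h0 s 0
      have hexp : exp (-(5 * M * s)) ≤ 1 := by
        rw [exp_le_one_iff, neg_nonpos]; have := hs.1; positivity
      have hk : 0 ≤ M := hM0
      have h1 : ε ^ 2 * exp (-M) * X s 0 ^ 2 ≤ μ := by
        simpa [hμ] using mul_le_mul_of_nonneg_left ha (by positivity : 0 ≤ ε ^ 2 * exp (-M))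
      have h2 : ε⁻¹ * M * X s 1 * X s 2 ≤ 5 * M * X s 2 := by
        have hb' : X s 1 ≤ 5 * ε := (le_abs_self _).trans hb
        have h5 : ε⁻¹ * X s 1 ≤ 5 := by
          rw [inv_mul_le_iff₀ hε]; linarith
        have : ε⁻¹ * M * X s 1 * X s 2 = (ε⁻¹ * X s 1) * (M * X s 2) := by ring
        rw [this]
        nlinarith [mul_nonneg hk hc0]
      have hbr : ε ^ 2 * exp (-M) * X s 0 ^ 2 + ε⁻¹ * M * X s 1 * X s 2
          - 5 * M * X s 2 ≤ μ := by linarith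
      calc (ε ^ 2 * exp (-M) * X s 0 ^ 2 + ε⁻¹ * M * X s 1 * X s 2
            - 5 * M * X s 2) * exp (-(5 * M * s))
          ≤ μ * exp (-(5 * M * s)) := mul_le_mul_of_nonneg_right hbr (exp_pos _).le
        _ ≤ μ * 1 := mul_le_mul_of_nonneg_left hexp hμ0
        _ = μ := mul_one _)
  have h0mem : (0 : ℝ) ∈ Icc (0 : ℝ) 2 := ⟨le_rfl, by norm_num⟩
  have h := hanti h0mem ht ht.1
  simp only [init_c h0, zero_mul, mul_zero, sub_zero] at h
  -- `c t * exp(-5kt) - μ t ≤ 0`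
  have h' : X t 2 * exp (-(5 * M * t)) ≤ μ * t := by linarith
  have hexp : X t 2 = X t 2 * exp (-(5 * M * t)) * exp (5 * M * t) := by
    rw [mul_assoc, ← exp_add, neg_add_cancel, exp_zero, mul_one]
  rw [hexp]
  calc X t 2 * exp (-(5 * M * t)) * exp (5 * M * t)
      ≤ μ * t * exp (5 * M * t) := mul_le_mul_of_nonneg_right h' (exp_pos _).le
    _ ≤ μ * 2 * exp (5 * M * t) := by
        have := ht.2
        exact mul_le_mul_of_nonneg_right (mul_le_mul_of_nonneg_left this hμ0) (exp_pos _).le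
    _ = 2 * ε ^ 2 * exp ((5 * t - 1) * M) := by
        simp only [hμ]
        rw [show (5 * t - 1) * M = -M + 5 * M * t by ring, exp_add]
        ring

end Trajectory


section PhaseOne

/-! ## Up to the critical time: (dora), (able2), (bogo-2) and the sharp comparison for `c`

Throughout, `τ` is a time with `c ≤ K⁻¹⁰ε²` on `[0,τ]` ((boots); it will be the hitting time). -/

variable {K M ε τ : ℝ} {X : ℝ → Fin 5 → ℝ}

/-- (dora): `|d|, |ã| ≤ 3K⁻¹⁰` on `[0,τ]`, from `∂ₜ(d²+ã²) = 2ε⁻²c·a·d` applied to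
`√(d²+ã²+K⁻²⁰)`. [cite: Tao2016AveragedNS, §5.5 (dora)] -/
theorem de_small (hX : ∀ t, HasDerivAt X (delayCircuitWith K M ε (X t)) t) (h0 : X 0 = delayInit)
    (hε : 0 < ε) (hK : 0 < K) (hτ2 : τ ≤ 2)
    (hcτ : ∀ t, 0 ≤ t → t ≤ τ → X t 2 ≤ ε ^ 2 / K ^ 10)
    {t : ℝ} (ht : t ∈ Icc 0 τ) : |X t 3| ≤ 3 / K ^ 10 ∧ |X t 4| ≤ 3 / K ^ 10 := by
  set κ : ℝ := (K ^ 10)⁻¹ with hκ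
  have hκ0 : 0 < κ := by positivity
  set u : ℝ → ℝ := fun s => X s 3 ^ 2 + X s 4 ^ 2 with hu
  set h : ℝ → ℝ := fun s => sqrt (u s + κ ^ 2) with hh
  have hupos : ∀ s, 0 < u s + κ ^ 2 := fun s => by positivity
  have hd_le : ∀ s, |X s 3| ≤ h s := fun s =>
    abs_le_sqrt (by simp only [hu]; nlinarith [sq_nonneg (X s 4)])
  have he_le : ∀ s, |X s 4| ≤ h s := fun s =>
    abs_le_sqrt (by simp only [hu]; nlinarith [sq_nonneg (X s 3)])
  have hder : ∀ s, HasDerivAt h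
      ((2 * (ε ^ 2)⁻¹ * X s 2 * X s 0 * X s 3) / (2 * sqrt (u s + κ ^ 2))) s := fun s =>
    ((delayCircuitWith_out_energy (hX s)).add_const (κ ^ 2)).sqrt (hupos s).ne'
  have hbound : ∀ s ∈ Icc 0 τ,
      (2 * (ε ^ 2)⁻¹ * X s 2 * X s 0 * X s 3) / (2 * sqrt (u s + κ ^ 2)) ≤ κ := by
    intro s hs
    have hhpos : 0 < sqrt (u s + κ ^ 2) := sqrt_pos.2 (hupos s)
    rw [div_le_iff₀ (by positivity)]
    have hc0 : 0 ≤ X s 2 := c_nonneg hX h0 hs.1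
    have hcθ : X s 2 ≤ ε ^ 2 / K ^ 10 := hcτ s hs.1 hs.2
    have ha : |X s 0| ≤ 1 := traj_abs_le_one hX h0 s 0
    have hds : |X s 3| ≤ h s := hd_le s
    have hh' : h s = sqrt (u s + κ ^ 2) := rfl
    rw [← hh']
    have h1 : |X s 0 * X s 3| ≤ h s := by
      rw [abs_mul]
      calc |X s 0| * |X s 3| ≤ 1 * h s := mul_le_mul ha hds (abs_nonneg _) zero_le_one
        _ = h s := one_mul _
    have h2 : (ε ^ 2)⁻¹ * X s 2 ≤ κ := by
      calc (ε ^ 2)⁻¹ * X s 2 ≤ (ε ^ 2)⁻¹ * (ε ^ 2 / K ^ 10) :=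
            mul_le_mul_of_nonneg_left hcθ (by positivity)
        _ = κ := by simp only [hκ]; field_simp
    have h3 : 0 ≤ (ε ^ 2)⁻¹ * X s 2 := by positivity
    have h4 : (ε ^ 2)⁻¹ * X s 2 * (X s 0 * X s 3) ≤ κ * h s :=
      calc (ε ^ 2)⁻¹ * X s 2 * (X s 0 * X s 3) ≤ (ε ^ 2)⁻¹ * X s 2 * |X s 0 * X s 3| :=
            mul_le_mul_of_nonneg_left (le_abs_self _) h3
        _ ≤ κ * h s := mul_le_mul h2 h1 (abs_nonneg _) hκ0.le
    have : 2 * (ε ^ 2)⁻¹ * X s 2 * X s 0 * X s 3 = 2 * ((ε ^ 2)⁻¹ * X s 2 * (X s 0 * X s 3)) := by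
      ring
    rw [this]
    linarith
  have hanti := antitoneOn_sub_of_deriv_le (Φ := fun s => κ * s) (convex_Icc 0 τ)
    (fun s _ => hder s) (fun s _ => ((hasDerivAt_id s).const_mul κ).congr_deriv (by simp)) hbound
  have h0mem : (0 : ℝ) ∈ Icc (0 : ℝ) τ := ⟨le_rfl, ht.1.trans ht.2⟩
  have hmono := hanti h0mem ht ht.1
  have hh0 : h 0 = κ := by
    simp only [hh, hu, init_d h0, init_e h0]
    simpa using sqrt_sq hκ0.le
  simp only [hh0, mul_zero, sub_zero] at hmono
  have hht : h t ≤ 3 / K ^ 10 := by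
    have ht2 : t ≤ 2 := ht.2.trans hτ2
    have : h t ≤ κ + κ * t := by linarith
    calc h t ≤ κ + κ * t := this
      _ ≤ κ + κ * 2 := by nlinarith
      _ = 3 / K ^ 10 := by simp only [hκ]; ring
  exact ⟨(hd_le t).trans hht, (he_le t).trans hht⟩

/-- (able2) for `a`: `|a - 1| ≤ 8K⁻²⁰` on `[0,τ]` (from `∂ₜa = O(K⁻²⁰) + O(ε²)`).
[cite: Tao2016AveragedNS, §5.5 (able2)] -/
theorem a_near_one (hX : ∀ t, HasDerivAt X (delayCircuitWith K M ε (X t)) t) (h0 : X 0 = delayInit)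
    (hε : 0 < ε) (hε1 : ε ≤ 1) (hM0 : 0 ≤ M) (hK : 0 < K) (hτ2 : τ ≤ 2)
    (hεK : ε ^ 2 ≤ 1 / (6 * K ^ 20))
    (hcτ : ∀ t, 0 ≤ t → t ≤ τ → X t 2 ≤ ε ^ 2 / K ^ 10)
    {t : ℝ} (ht : t ∈ Icc 0 τ) : |X t 0 - 1| ≤ 8 / K ^ 20 := by
  have hM : ∀ s ∈ Icc 0 τ, |(-((ε ^ 2)⁻¹ * X s 2 * X s 3) - ε * X s 0 * X s 1
      - ε ^ 2 * exp (-M) * X s 0 * X s 2)| ≤ 4 / K ^ 20 := by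
    intro s hs
    have hs2 : s ∈ Icc (0 : ℝ) 2 := ⟨hs.1, hs.2.trans hτ2⟩
    have hc0 : 0 ≤ X s 2 := c_nonneg hX h0 hs.1
    have hcθ : X s 2 ≤ ε ^ 2 / K ^ 10 := hcτ s hs.1 hs.2
    have hd : |X s 3| ≤ 3 / K ^ 10 := (de_small hX h0 hε hK hτ2 hcτ hs).1
    have ha : |X s 0| ≤ 1 := traj_abs_le_one hX h0 s 0
    have hb : |X s 1| ≤ 5 * ε := (bc_small hX h0 hε hε1 hM0 hs2).1
    have hc1 : |X s 2| ≤ 1 := traj_abs_le_one hX h0 s 2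
    have hek : exp (-M) ≤ 1 := by rw [exp_le_one_iff, neg_nonpos]; exact hM0
    -- term 1: `|ρ c d| ≤ 3 K⁻²⁰`
    have h1 : |(ε ^ 2)⁻¹ * X s 2 * X s 3| ≤ 3 / K ^ 20 := by
      rw [abs_mul, abs_of_nonneg (by positivity : 0 ≤ (ε ^ 2)⁻¹ * X s 2)]
      calc (ε ^ 2)⁻¹ * X s 2 * |X s 3| ≤ (ε ^ 2)⁻¹ * (ε ^ 2 / K ^ 10) * (3 / K ^ 10) :=
            mul_le_mul (mul_le_mul_of_nonneg_left hcθ (by positivity)) hd (abs_nonneg _)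
              (by positivity)
        _ = 3 / K ^ 20 := by field_simp
    -- term 2: `|ε a b| ≤ 5ε²`
    have h2 : |ε * X s 0 * X s 1| ≤ 5 * ε ^ 2 := by
      rw [abs_mul, abs_mul, abs_of_pos hε]
      calc ε * |X s 0| * |X s 1| ≤ ε * 1 * (5 * ε) :=
            mul_le_mul (mul_le_mul_of_nonneg_left ha hε.le) hb (abs_nonneg _) (by positivity)
        _ = 5 * ε ^ 2 := by ring
    -- term 3: `|μ a c| ≤ ε²`
    have h3 : |ε ^ 2 * exp (-M) * X s 0 * X s 2| ≤ ε ^ 2 := by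
      rw [abs_mul, abs_mul, abs_mul, abs_of_pos (pow_pos hε 2), abs_of_pos (exp_pos _)]
      calc ε ^ 2 * exp (-M) * |X s 0| * |X s 2| ≤ ε ^ 2 * 1 * 1 * 1 :=
            mul_le_mul (mul_le_mul (mul_le_mul_of_nonneg_left hek (by positivity)) ha
              (abs_nonneg _) (by positivity)) hc1 (abs_nonneg _) (by positivity)
        _ = ε ^ 2 := by ring
    have h6 : 6 * ε ^ 2 ≤ 1 / K ^ 20 := by
      have := hεK
      rw [le_div_iff₀ (by positivity)] at this
      rw [le_div_iff₀ (by positivity)]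
      linarith
    calc |(-((ε ^ 2)⁻¹ * X s 2 * X s 3) - ε * X s 0 * X s 1 - ε ^ 2 * exp (-M) * X s 0 * X s 2)|
        ≤ |(-((ε ^ 2)⁻¹ * X s 2 * X s 3) - ε * X s 0 * X s 1)|
          + |ε ^ 2 * exp (-M) * X s 0 * X s 2| := abs_sub _ _
      _ ≤ |(-((ε ^ 2)⁻¹ * X s 2 * X s 3))| + |ε * X s 0 * X s 1|
          + |ε ^ 2 * exp (-M) * X s 0 * X s 2| := by
          have := abs_sub (-((ε ^ 2)⁻¹ * X s 2 * X s 3)) (ε * X s 0 * X s 1)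
          linarith
      _ ≤ 3 / K ^ 20 + 5 * ε ^ 2 + ε ^ 2 := by rw [abs_neg]; linarith
      _ ≤ 4 / K ^ 20 := by
          have : 3 / K ^ 20 + 6 * ε ^ 2 ≤ 3 / K ^ 20 + 1 / K ^ 20 := by linarith
          calc 3 / K ^ 20 + 5 * ε ^ 2 + ε ^ 2 = 3 / K ^ 20 + 6 * ε ^ 2 := by ring
            _ ≤ 3 / K ^ 20 + 1 / K ^ 20 := this
            _ = 4 / K ^ 20 := by ring
  have := abs_sub_le_of_abs_deriv_le (fun s _ => hasDerivAt_a hX s) hM ht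
  rw [init_a h0, sub_zero] at this
  calc |X t 0 - 1| ≤ 4 / K ^ 20 * t := this
    _ ≤ 4 / K ^ 20 * 2 := by
        have : t ≤ 2 := ht.2.trans hτ2
        exact mul_le_mul_of_nonneg_left this (by positivity)
    _ = 8 / K ^ 20 := by ring

/-- (bogo-2): `|b - εt| ≤ 17εt·K⁻²⁰` on `[0,τ]` (from `∂ₜb = ε + O(K⁻²⁰ε) + O(K⁻¹⁰ε³)`).
[cite: Tao2016AveragedNS, §5.5 (bogo-2)] -/
theorem b_linear (hX : ∀ t, HasDerivAt X (delayCircuitWith K M ε (X t)) t) (h0 : X 0 = delayInit)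
    (hε : 0 < ε) (hε1 : ε ≤ 1) (hM0 : 0 < M) (hMK : M ≤ K ^ 10) (hK : 1 ≤ K) (hτ2 : τ ≤ 2)
    (hεK : ε ^ 2 ≤ 1 / (6 * K ^ 20))
    (hcτ : ∀ t, 0 ≤ t → t ≤ τ → X t 2 ≤ ε ^ 2 / K ^ 10)
    {t : ℝ} (ht : t ∈ Icc 0 τ) : |X t 1 - ε * t| ≤ 17 * ε / K ^ 20 * t := by
  have hK0 : 0 < K := by linarith
  have hM : ∀ s ∈ Icc 0 τ,
      |ε * X s 0 ^ 2 - ε⁻¹ * M * X s 2 ^ 2 - ε * 1| ≤ 17 * ε / K ^ 20 := by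
    intro s hs
    have hc0 : 0 ≤ X s 2 := c_nonneg hX h0 hs.1
    have hcθ : X s 2 ≤ ε ^ 2 / K ^ 10 := hcτ s hs.1 hs.2
    have ha1 : |X s 0 - 1| ≤ 8 / K ^ 20 := a_near_one hX h0 hε hε1 hM0.le hK0 hτ2 hεK hcτ hs
    have ha : |X s 0| ≤ 1 := traj_abs_le_one hX h0 s 0
    -- `|ε (a² - 1)| ≤ 16 ε K⁻²⁰`
    have h1 : |ε * (X s 0 ^ 2 - 1)| ≤ 16 * ε / K ^ 20 := by
      rw [abs_mul, abs_of_pos hε, show X s 0 ^ 2 - 1 = (X s 0 - 1) * (X s 0 + 1) by ring, abs_mul]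
      have hp1 : |X s 0 + 1| ≤ 2 := by
        calc |X s 0 + 1| ≤ |X s 0| + |1| := abs_add_le _ _
          _ ≤ 1 + 1 := by rw [abs_one]; linarith
          _ = 2 := by norm_num
      calc ε * (|X s 0 - 1| * |X s 0 + 1|) ≤ ε * (8 / K ^ 20 * 2) :=
            mul_le_mul_of_nonneg_left (mul_le_mul ha1 hp1 (abs_nonneg _) (by positivity)) hε.le
        _ = 16 * ε / K ^ 20 := by ring
    -- `0 ≤ ν c² ≤ M ε³ K⁻²⁰ ≤ ε K⁻²⁰` (`M ε² ≤ K¹⁰ε² ≤ 1`)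
    have h2 : 0 ≤ ε⁻¹ * M * X s 2 ^ 2 := by
      have := hM0.le
      positivity
    have h3 : ε⁻¹ * M * X s 2 ^ 2 ≤ ε / K ^ 20 := by
      have hc2 : X s 2 ^ 2 ≤ (ε ^ 2 / K ^ 10) ^ 2 := pow_le_pow_left₀ hc0 hcθ 2
      have hMε : M * ε ^ 2 ≤ 1 := by
        have hK20 : (1 : ℝ) ≤ K ^ 20 := one_le_pow₀ hK
        calc M * ε ^ 2 ≤ K ^ 10 * (1 / (6 * K ^ 20)) :=
              mul_le_mul hMK hεK (by positivity) (by positivity)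
          _ = K ^ 10 / K ^ 20 / 6 := by field_simp
          _ ≤ 1 / 1 / 6 := by
              have : K ^ 10 / K ^ 20 ≤ 1 := by
                rw [div_le_one (by positivity)]
                exact pow_le_pow_right₀ hK (by norm_num)
              linarith
          _ ≤ 1 := by norm_num
      calc ε⁻¹ * M * X s 2 ^ 2 ≤ ε⁻¹ * M * (ε ^ 2 / K ^ 10) ^ 2 :=
            mul_le_mul_of_nonneg_left hc2 (by have := hM0.le; positivity)
        _ = ε * (M * ε ^ 2) / K ^ 20 := by field_simp
        _ ≤ ε * 1 / K ^ 20 := by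
            exact div_le_div_of_nonneg_right (mul_le_mul_of_nonneg_left hMε hε.le) (by positivity)
        _ = ε / K ^ 20 := by ring
    rw [show ε * X s 0 ^ 2 - ε⁻¹ * M * X s 2 ^ 2 - ε * 1
        = ε * (X s 0 ^ 2 - 1) - ε⁻¹ * M * X s 2 ^ 2 by ring]
    calc |ε * (X s 0 ^ 2 - 1) - ε⁻¹ * M * X s 2 ^ 2|
        ≤ |ε * (X s 0 ^ 2 - 1)| + |ε⁻¹ * M * X s 2 ^ 2| := abs_sub _ _
      _ ≤ 16 * ε / K ^ 20 + ε / K ^ 20 := by rw [abs_of_nonneg h2]; linarith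
      _ = 17 * ε / K ^ 20 := by ring
  have hder : ∀ s ∈ Icc 0 τ, HasDerivAt (fun r => X r 1 - ε * r)
      (ε * X s 0 ^ 2 - ε⁻¹ * M * X s 2 ^ 2 - ε * 1) s := fun s _ =>
    (hasDerivAt_b hX s).sub ((hasDerivAt_id s).const_mul ε)
  have := abs_sub_le_of_abs_deriv_le hder hM ht
  simpa [init_b h0] using this

/-- Sharp super-solution for `c` on `[0,τ]`: `c(t) ≤ 2ε² exp(Mt²/2 + 1 - M)` (integrating
factor `exp(-(Mt²/2 + βt))`, `β = 34M K⁻²⁰ ≤ 34K⁻¹⁰`). [cite: Tao2016AveragedNS, §5.5 proof of (tcable)] -/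
theorem c_upper_sharp (hX : ∀ t, HasDerivAt X (delayCircuitWith K M ε (X t)) t) (h0 : X 0 = delayInit)
    (hε : 0 < ε) (hε1 : ε ≤ 1) (hM0 : 0 < M) (hMK : M ≤ K ^ 10) (hK : 2 ≤ K) (hτ2 : τ ≤ 2)
    (hεK : ε ^ 2 ≤ 1 / (6 * K ^ 20))
    (hcτ : ∀ t, 0 ≤ t → t ≤ τ → X t 2 ≤ ε ^ 2 / K ^ 10)
    {t : ℝ} (ht : t ∈ Icc 0 τ) :
    X t 2 ≤ 2 * ε ^ 2 * exp (M * t ^ 2 / 2 + 1 - M) := by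
  have hK0 : 0 < K := by linarith
  have hK1 : 1 ≤ K := by linarith
  have hK68 : 68 ≤ K ^ 10 := by
    have : (2 : ℝ) ^ 10 ≤ K ^ 10 := pow_le_pow_left₀ (by norm_num) hK 10
    nlinarith
  set β : ℝ := 34 * M / K ^ 20 with hβ
  have hβ0 : 0 ≤ β := by positivity
  have hβ1 : β ≤ 1 / 2 := by
    simp only [hβ]; rw [div_le_div_iff₀ (by positivity) (by norm_num)]
    have : K ^ 20 = K ^ 10 * K ^ 10 := by ring
    nlinarith [pow_pos hK0 10]
  set k : ℝ := M with hk
  have hk0 : 0 < k := hM0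
  set μ : ℝ := ε ^ 2 * exp (-k) with hμ
  have hμ0 : 0 ≤ μ := by positivity
  -- integrating factor `G(s) = k s²/2 + β s`
  have hG : ∀ s, HasDerivAt (fun r : ℝ => k / 2 * (r * r) + β * r) (k * s + β) s := by
    intro s
    have := (((hasDerivAt_id s).mul (hasDerivAt_id s)).const_mul (k / 2)).add
      ((hasDerivAt_id s).const_mul β)
    exact this.congr_deriv (by simp; ring)
  have hanti := antitoneOn_intFactor (s := Icc 0 τ) (g := fun s => k * s + β)
    (G := fun r => k / 2 * (r * r) + β * r) (φ := fun _ => μ) (Φ := fun s => μ * s)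
    (convex_Icc 0 τ) (fun s _ => hasDerivAt_c hX s) (fun s _ => hG s)
    (fun s _ => ((hasDerivAt_id s).const_mul μ).congr_deriv (by simp))
    (fun s hs => by
      have hc0 : 0 ≤ X s 2 := c_nonneg hX h0 hs.1
      have ha : X s 0 ^ 2 ≤ 1 := traj_sq_le_one hX h0 s 0
      have hb : |X s 1 - ε * s| ≤ 17 * ε / K ^ 20 * s :=
        b_linear hX h0 hε hε1 hM0 hMK hK1 hτ2 hεK hcτ hs
      have hs2 : s ≤ 2 := hs.2.trans hτ2
      -- `ν b ≤ k s + β`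
      have hνb : ε⁻¹ * M * X s 1 ≤ k * s + β := by
        have hb' : X s 1 ≤ ε * s + 17 * ε / K ^ 20 * s := by
          have := (abs_le.1 hb).2; linarith
        have h34 : 17 * ε / K ^ 20 * s ≤ 34 * ε / K ^ 20 := by
          have h2s : 17 * ε / K ^ 20 * s ≤ 17 * ε / K ^ 20 * 2 :=
            mul_le_mul_of_nonneg_left hs2 (by positivity)
          have h2e : 17 * ε / K ^ 20 * 2 = 34 * ε / K ^ 20 := by ring
          linarith
        calc ε⁻¹ * M * X s 1 ≤ ε⁻¹ * M * (ε * s + 34 * ε / K ^ 20) :=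
              mul_le_mul_of_nonneg_left (by linarith) (by positivity)
          _ = k * s + β := by
              simp only [hβ, hk]; field_simp
      have hexp : exp (-(k / 2 * (s * s) + β * s)) ≤ 1 := by
        rw [exp_le_one_iff, neg_nonpos]; have := hs.1; positivity
      have hbr : ε ^ 2 * exp (-M) * X s 0 ^ 2 + ε⁻¹ * M * X s 1 * X s 2
          - (k * s + β) * X s 2 ≤ μ := by
        have h1 : ε ^ 2 * exp (-M) * X s 0 ^ 2 ≤ μ := by
          simpa [hμ, hk] using mul_le_mul_of_nonneg_left ha
            (by positivity : 0 ≤ ε ^ 2 * exp (-M))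
        have h2 : ε⁻¹ * M * X s 1 * X s 2 ≤ (k * s + β) * X s 2 :=
          mul_le_mul_of_nonneg_right hνb hc0
        linarith
      calc (ε ^ 2 * exp (-M) * X s 0 ^ 2 + ε⁻¹ * M * X s 1 * X s 2
            - (k * s + β) * X s 2) * exp (-(k / 2 * (s * s) + β * s))
          ≤ μ * exp (-(k / 2 * (s * s) + β * s)) :=
            mul_le_mul_of_nonneg_right hbr (exp_pos _).le
        _ ≤ μ * 1 := mul_le_mul_of_nonneg_left hexp hμ0
        _ = μ := mul_one _)
  have h0mem : (0 : ℝ) ∈ Icc (0 : ℝ) τ := ⟨le_rfl, ht.1.trans ht.2⟩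
  have h := hanti h0mem ht ht.1
  simp only [init_c h0, zero_mul, mul_zero, sub_zero, add_zero] at h
  have h' : X t 2 * exp (-(k / 2 * (t * t) + β * t)) ≤ μ * t := by linarith
  have ht2 : t ≤ 2 := ht.2.trans hτ2
  have hE : X t 2 = X t 2 * exp (-(k / 2 * (t * t) + β * t)) * exp (k / 2 * (t * t) + β * t) := by
    rw [mul_assoc, ← exp_add, neg_add_cancel, exp_zero, mul_one]
  rw [hE]
  calc X t 2 * exp (-(k / 2 * (t * t) + β * t)) * exp (k / 2 * (t * t) + β * t)
      ≤ μ * t * exp (k / 2 * (t * t) + β * t) := mul_le_mul_of_nonneg_right h' (exp_pos _).le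
    _ ≤ μ * 2 * exp (k / 2 * (t * t) + 1) := by
        have hβt : β * t ≤ 1 := by nlinarith
        exact mul_le_mul (mul_le_mul_of_nonneg_left ht2 hμ0) (exp_le_exp.2 (by linarith))
          (exp_pos _).le (by positivity)
    _ = 2 * ε ^ 2 * exp (M * t ^ 2 / 2 + 1 - M) := by
        simp only [hμ, hk]
        rw [show M * t ^ 2 / 2 + 1 - M = -M + (M / 2 * (t * t) + 1) by ring,
          exp_add (-M)]
        ring

/-- Sharp sub-solution for `c` on `[K⁻⁵, τ]` (needs `K⁻⁵ ≤ τ`):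
`c(t) ≥ (ε²/(4K⁵)) exp(Mt²/2 - 1 - M)` (integrating factor `exp(-(Mt²/2 - βt))`, first on
`[0,K⁻⁵]` where it is `≥ e^{-1/2}` because `M K⁻¹⁰ ≤ 1`, then on `[K⁻⁵,τ]`).
[cite: Tao2016AveragedNS, §5.5 proof of (tcable)] -/
theorem c_lower_sharp (hX : ∀ t, HasDerivAt X (delayCircuitWith K M ε (X t)) t) (h0 : X 0 = delayInit)
    (hε : 0 < ε) (hε1 : ε ≤ 1) (hM0 : 0 < M) (hMK : M ≤ K ^ 10) (hK : 2 ≤ K) (hτ2 : τ ≤ 2)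
    (hτ5 : (K ^ 5)⁻¹ ≤ τ)
    (hεK : ε ^ 2 ≤ 1 / (6 * K ^ 20))
    (hcτ : ∀ t, 0 ≤ t → t ≤ τ → X t 2 ≤ ε ^ 2 / K ^ 10)
    {t : ℝ} (ht : t ∈ Icc (K ^ 5)⁻¹ τ) :
    ε ^ 2 / (4 * K ^ 5) * exp (M * t ^ 2 / 2 - 1 - M) ≤ X t 2 := by
  have hK0 : 0 < K := by linarith
  have hK1 : 1 ≤ K := by linarith
  have hK68 : 68 ≤ K ^ 10 := by
    have : (2 : ℝ) ^ 10 ≤ K ^ 10 := pow_le_pow_left₀ (by norm_num) hK 10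
    nlinarith
  set β : ℝ := 34 * M / K ^ 20 with hβ
  have hβ0 : 0 ≤ β := by positivity
  have hβ1 : β ≤ 1 / 2 := by
    simp only [hβ]; rw [div_le_div_iff₀ (by positivity) (by norm_num)]
    have : K ^ 20 = K ^ 10 * K ^ 10 := by ring
    nlinarith [pow_pos hK0 10]
  have hks₀' : M * ((K ^ 5)⁻¹ * (K ^ 5)⁻¹) ≤ 1 := by
    rw [← mul_inv, ← pow_add, show (5 + 5 : ℕ) = 10 from rfl, ← div_eq_mul_inv,
      div_le_one (by positivity)]
    exact hMK
  set k : ℝ := M with hk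
  have hk0 : 0 < k := hM0
  set μ : ℝ := ε ^ 2 * exp (-k) with hμ
  have hμ0 : 0 ≤ μ := by positivity
  set s₀ : ℝ := (K ^ 5)⁻¹ with hs₀
  have hs₀0 : 0 < s₀ := by positivity
  have hks₀ : k * (s₀ * s₀) ≤ 1 := hks₀'
  -- integrating factor `G(s) = k s²/2 - β s`
  have hG : ∀ s, HasDerivAt (fun r : ℝ => k / 2 * (r * r) - β * r) (k * s - β) s := by
    intro s
    have := (((hasDerivAt_id s).mul (hasDerivAt_id s)).const_mul (k / 2)).sub
      ((hasDerivAt_id s).const_mul β)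
    exact this.congr_deriv (by simp; ring)
  -- the bracket `(c' - (ks-β)c) e^{-G} ≥ (μ/2) e^{-G}` on `[0,τ]`
  have hbr : ∀ s ∈ Icc 0 τ, μ / 2 * exp (-(k / 2 * (s * s) - β * s)) ≤
      (ε ^ 2 * exp (-M) * X s 0 ^ 2 + ε⁻¹ * M * X s 1 * X s 2
        - (k * s - β) * X s 2) * exp (-(k / 2 * (s * s) - β * s)) := by
    intro s hs
    have hc0 : 0 ≤ X s 2 := c_nonneg hX h0 hs.1
    have ha1 : |X s 0 - 1| ≤ 8 / K ^ 20 := a_near_one hX h0 hε hε1 hM0.le hK0 hτ2 hεK hcτ hs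
    have hb : |X s 1 - ε * s| ≤ 17 * ε / K ^ 20 * s :=
      b_linear hX h0 hε hε1 hM0 hMK hK1 hτ2 hεK hcτ hs
    have hs2 : s ≤ 2 := hs.2.trans hτ2
    -- `a² ≥ 1/2`
    have hK20 : 8 / K ^ 20 ≤ 1 / 4 := by
      rw [div_le_div_iff₀ (by positivity) (by norm_num)]
      have : (2 : ℝ) ^ 20 ≤ K ^ 20 := pow_le_pow_left₀ (by norm_num) hK 20
      nlinarith
    have ha_lo : 3 / 4 ≤ X s 0 := by have := (abs_le.1 ha1).1; linarith
    have ha2 : 1 / 2 ≤ X s 0 ^ 2 := by nlinarith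
    -- `ν b ≥ k s - β`
    have hνb : k * s - β ≤ ε⁻¹ * M * X s 1 := by
      have hb' : ε * s - 17 * ε / K ^ 20 * s ≤ X s 1 := by
        have := (abs_le.1 hb).1; linarith
      have h34 : 17 * ε / K ^ 20 * s ≤ 34 * ε / K ^ 20 := by
        have h2s : 17 * ε / K ^ 20 * s ≤ 17 * ε / K ^ 20 * 2 :=
          mul_le_mul_of_nonneg_left hs2 (by positivity)
        have h2e : 17 * ε / K ^ 20 * 2 = 34 * ε / K ^ 20 := by ring
        linarith
      calc k * s - β = ε⁻¹ * M * (ε * s - 34 * ε / K ^ 20) := by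
            simp only [hβ, hk]; field_simp
        _ ≤ ε⁻¹ * M * X s 1 :=
            mul_le_mul_of_nonneg_left (by linarith) (by positivity)
    have h1 : μ / 2 ≤ ε ^ 2 * exp (-M) * X s 0 ^ 2 := by
      have : ε ^ 2 * exp (-M) * (1 / 2) ≤ ε ^ 2 * exp (-M) * X s 0 ^ 2 :=
        mul_le_mul_of_nonneg_left ha2 (by positivity)
      simp only [hμ, hk] at this ⊢; linarith
    have h2 : (k * s - β) * X s 2 ≤ ε⁻¹ * M * X s 1 * X s 2 :=
      mul_le_mul_of_nonneg_right hνb hc0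
    have hbr' : μ / 2 ≤ ε ^ 2 * exp (-M) * X s 0 ^ 2 + ε⁻¹ * M * X s 1 * X s 2
        - (k * s - β) * X s 2 := by linarith
    exact mul_le_mul_of_nonneg_right hbr' (exp_pos _).le
  -- Stage A: on `[0, s₀]`, `e^{-G} ≥ 1/2`, so `c e^{-G} - (μ/4) s` is monotone
  have hs₀τ : s₀ ≤ τ := hτ5
  have hmonoA := monotoneOn_intFactor (s := Icc 0 s₀) (g := fun s => k * s - β)
    (G := fun r => k / 2 * (r * r) - β * r) (φ := fun _ => μ / 4) (Φ := fun s => μ / 4 * s)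
    (convex_Icc 0 s₀) (fun s _ => hasDerivAt_c hX s) (fun s _ => hG s)
    (fun s _ => ((hasDerivAt_id s).const_mul (μ / 4)).congr_deriv (by simp))
    (fun s hs => by
      have hsτ : s ∈ Icc 0 τ := ⟨hs.1, hs.2.trans hs₀τ⟩
      have hexp : 1 / 2 ≤ exp (-(k / 2 * (s * s) - β * s)) := by
        have hss : k * (s * s) ≤ 1 := by
          calc k * (s * s) ≤ k * (s₀ * s₀) := by
                exact mul_le_mul_of_nonneg_left (mul_self_le_mul_self hs.1 hs.2) hk0.le
            _ ≤ 1 := hks₀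
        have harg : -(1 / 2 : ℝ) ≤ -(k / 2 * (s * s) - β * s) := by
          have : 0 ≤ β * s := mul_nonneg hβ0 hs.1
          linarith
        calc (1 / 2 : ℝ) ≤ exp (-(1 / 2 : ℝ)) := by
              have h := Real.add_one_le_exp (-(1 / 2 : ℝ))
              linarith
          _ ≤ exp (-(k / 2 * (s * s) - β * s)) := exp_le_exp.2 harg
      calc μ / 4 = μ / 2 * (1 / 2) := by ring
        _ ≤ μ / 2 * exp (-(k / 2 * (s * s) - β * s)) :=
            mul_le_mul_of_nonneg_left hexp (by positivity)
        _ ≤ _ := hbr s hsτ)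
  have hA := hmonoA (⟨le_rfl, hs₀0.le⟩ : (0 : ℝ) ∈ Icc 0 s₀) ⟨hs₀0.le, le_rfl⟩ hs₀0.le
  simp only [init_c h0, zero_mul, mul_zero, sub_zero] at hA
  -- Stage B: on `[s₀, τ]`, `c e^{-G}` is monotone
  have hmonoB := monotoneOn_intFactor (s := Icc s₀ τ) (g := fun s => k * s - β)
    (G := fun r => k / 2 * (r * r) - β * r) (φ := fun _ => 0) (Φ := fun _ => 0)
    (convex_Icc s₀ τ) (fun s _ => hasDerivAt_c hX s) (fun s _ => hG s)
    (fun s _ => hasDerivAt_const s (0 : ℝ))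
    (fun s hs => by
      have hsτ : s ∈ Icc 0 τ := ⟨hs₀0.le.trans hs.1, hs.2⟩
      exact le_trans (by positivity) (hbr s hsτ))
  have hB := hmonoB (⟨le_rfl, hs₀τ⟩ : s₀ ∈ Icc s₀ τ) ht ht.1
  simp only [sub_zero] at hB
  -- combine: `c t e^{-G t} ≥ μ/4 s₀`
  have hct : μ / 4 * s₀ ≤ X t 2 * exp (-(k / 2 * (t * t) - β * t)) := by linarith
  have ht0 : 0 ≤ t := hs₀0.le.trans ht.1
  have ht2 : t ≤ 2 := ht.2.trans hτ2
  have hE : X t 2 = X t 2 * exp (-(k / 2 * (t * t) - β * t)) * exp (k / 2 * (t * t) - β * t) := by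
    rw [mul_assoc, ← exp_add, neg_add_cancel, exp_zero, mul_one]
  rw [hE]
  calc ε ^ 2 / (4 * K ^ 5) * exp (M * t ^ 2 / 2 - 1 - M)
      = μ / 4 * s₀ * exp (k / 2 * (t * t) - 1) := by
        simp only [hμ, hk, hs₀]
        rw [show M * t ^ 2 / 2 - 1 - M = -M + (M / 2 * (t * t) - 1) by ring,
          exp_add (-M)]
        field_simp
    _ ≤ μ / 4 * s₀ * exp (k / 2 * (t * t) - β * t) := by
        have hβt : β * t ≤ 1 := by nlinarith
        exact mul_le_mul_of_nonneg_left (exp_le_exp.2 (by linarith)) (by positivity)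
    _ ≤ X t 2 * exp (-(k / 2 * (t * t) - β * t)) * exp (k / 2 * (t * t) - β * t) :=
        mul_le_mul_of_nonneg_right hct (exp_pos _).le

end PhaseOne


/-! ## Numerics for the critical window -/

section CriticalTime

/-! ## The critical window, read off from the hitting condition (no `K⁹` numerics) -/

variable {K M ε τ : ℝ} {X : ℝ → Fin 5 → ℝ}

/-- `log K ≥ 2` (`e² < 7.39 ≤ 16`), `log 2 ≤ log K` and `0 < log K` for `K ≥ 16`. [folklore] -/
theorem log_facts {K : ℝ} (hK : 16 ≤ K) :
    2 ≤ Real.log K ∧ Real.log 2 ≤ Real.log K ∧ 0 < Real.log K := by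
  have he : exp 2 ≤ K := by
    have h1 := Real.exp_one_lt_d9
    have h0 : 0 < exp 1 := exp_pos 1
    have : exp 2 = exp 1 * exp 1 := by rw [← exp_add]; norm_num
    rw [this]; nlinarith
  have h2 : (2 : ℝ) ≤ Real.log K :=
    calc (2 : ℝ) = Real.log (exp 2) := (Real.log_exp 2).symm
      _ ≤ Real.log K := Real.log_le_log (exp_pos 2) he
  exact ⟨h2, Real.log_le_log (by norm_num) (by linarith), by linarith⟩

/-- **(tcable) and (c-bound) for the family.** If `τ` is the first hitting time of the level
`K⁻¹⁰ε²` by `c` on `[0,2]`, then `2 - 24 log K / M ≤ τ² ≤ 2 + 2/M` (so `1 ≤ τ ≤ 3/2` once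
`48 log K ≤ M`) and `c(τ) = K⁻¹⁰ε²`. The lower edge is the super-solution evaluated at the hitting
time (`K⁻¹⁰ ≤ 2e^{Mτ²/2 + 1 - M}`, then `log`); the upper edge is the sub-solution at
`T = √(2 + 2/M)`, where it already exceeds the level (`4K⁵ < K¹⁰`).
[cite: Tao2016AveragedNS, §5.5 (tcable), (c-bound)] -/
theorem tc_window (hX : ∀ t, HasDerivAt X (delayCircuitWith K M ε (X t)) t) (h0 : X 0 = delayInit)
    (hε : 0 < ε) (hε1 : ε ≤ 1) (hM0 : 0 < M) (hMK : M ≤ K ^ 10) (hK : 16 ≤ K)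
    (hML : 48 * Real.log K ≤ M) (hεK : ε ^ 2 ≤ 1 / (6 * K ^ 20))
    (hτ0 : 0 < τ) (hτ2 : τ ≤ 2)
    (hcτ : ∀ t, 0 ≤ t → t ≤ τ → X t 2 ≤ ε ^ 2 / K ^ 10)
    (hτeq : τ < 2 → X τ 2 = ε ^ 2 / K ^ 10) :
    2 - 24 * Real.log K / M ≤ τ ^ 2 ∧ τ ^ 2 ≤ 2 + 2 / M ∧ 1 ≤ τ ∧ τ ≤ 3 / 2 ∧
      X τ 2 = ε ^ 2 / K ^ 10 := by
  have hK2 : 2 ≤ K := by linarith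
  have hK0 : 0 < K := by linarith
  obtain ⟨hlog, hlog2, hlog0⟩ := log_facts hK
  -- late side: `τ² ≤ 2 + 2/M`
  have hlate : τ ^ 2 ≤ 2 + 2 / M := by
    by_contra hlt'
    have hlt := not_le.1 hlt'
    set T := sqrt (2 + 2 / M) with hT
    have hT0 : 0 ≤ T := sqrt_nonneg _
    have hT2 : T ^ 2 = 2 + 2 / M := sq_sqrt (by positivity)
    have hTτ : T < τ := by
      rw [← hT2] at hlt
      exact lt_of_pow_lt_pow_left₀ 2 hτ0.le hlt
    have hT1 : 1 ≤ T := by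
      rw [hT, le_sqrt (by norm_num) (by positivity)]
      have : 0 ≤ 2 / M := by positivity
      linarith
    have hT5 : (K ^ 5)⁻¹ ≤ T := by
      have : (K ^ 5)⁻¹ ≤ 1 := inv_le_one_of_one_le₀ (one_le_pow₀ (by linarith))
      linarith
    have hτ5 : (K ^ 5)⁻¹ ≤ τ := by linarith
    have hlow := c_lower_sharp hX h0 hε hε1 hM0 hMK hK2 hτ2 hτ5 hεK hcτ (t := T) ⟨hT5, hTτ.le⟩
    have hcT : X T 2 ≤ ε ^ 2 / K ^ 10 := hcτ T (by linarith) hTτ.le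
    have hexp0 : M * T ^ 2 / 2 - 1 - M = 0 := by rw [hT2]; field_simp; ring
    rw [hexp0, exp_zero, mul_one] at hlow
    have h : ε ^ 2 / (4 * K ^ 5) ≤ ε ^ 2 / K ^ 10 := hlow.trans hcT
    rw [div_le_div_iff₀ (by positivity) (by positivity)] at h
    have hε2 : 0 < ε ^ 2 := by positivity
    have h' : K ^ 10 ≤ 4 * K ^ 5 := le_of_mul_le_mul_left (by linarith) hε2
    have h5 : (16 : ℝ) ^ 5 ≤ K ^ 5 := pow_le_pow_left₀ (by norm_num) hK 5
    nlinarith [pow_pos hK0 5]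
  have hM96 : 96 ≤ M := by linarith
  have hτ32 : τ ≤ 3 / 2 := by
    have h2M : 2 / M ≤ 1 / 4 := by
      rw [div_le_div_iff₀ hM0 (by norm_num)]; linarith
    nlinarith
  have hτlt2 : τ < 2 := by linarith
  have hcτeq := hτeq hτlt2
  -- early side: `2 - 24 log K / M ≤ τ²`
  have hearly : 2 - 24 * Real.log K / M ≤ τ ^ 2 := by
    have hup := c_upper_sharp hX h0 hε hε1 hM0 hMK hK2 hτ2 hεK hcτ (t := τ) ⟨hτ0.le, le_rfl⟩
    rw [hcτeq] at hup
    -- `1/(2K¹⁰) ≤ exp(Mτ²/2 + 1 - M)`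
    have h1 : 1 / (2 * K ^ 10) ≤ exp (M * τ ^ 2 / 2 + 1 - M) := by
      rw [div_le_iff₀ (by positivity)]
      have hε2 : 0 < ε ^ 2 := by positivity
      have : ε ^ 2 * 1 ≤ ε ^ 2 * (exp (M * τ ^ 2 / 2 + 1 - M) * (2 * K ^ 10)) := by
        calc ε ^ 2 * 1 = ε ^ 2 / K ^ 10 * K ^ 10 := by field_simp
          _ ≤ 2 * ε ^ 2 * exp (M * τ ^ 2 / 2 + 1 - M) * K ^ 10 :=
              mul_le_mul_of_nonneg_right hup (by positivity)
          _ = ε ^ 2 * (exp (M * τ ^ 2 / 2 + 1 - M) * (2 * K ^ 10)) := by ring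
      exact le_of_mul_le_mul_left this hε2
    have h2 : Real.log (1 / (2 * K ^ 10)) ≤ M * τ ^ 2 / 2 + 1 - M := by
      have := Real.log_le_log (by positivity) h1
      rwa [Real.log_exp] at this
    have h3 : Real.log (1 / (2 * K ^ 10)) = -(Real.log 2 + 10 * Real.log K) := by
      rw [one_div, Real.log_inv, Real.log_mul (by norm_num) (by positivity), Real.log_pow]
      push_cast; ring
    rw [h3] at h2
    -- `M (1 - τ²/2) ≤ 1 + log 2 + 10 log K ≤ 12 log K`
    have h4 : M * (2 - τ ^ 2) ≤ 24 * Real.log K := by nlinarith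
    have : 2 - τ ^ 2 ≤ 24 * Real.log K / M := by
      rw [le_div_iff₀ hM0]; linarith
    linarith
  have hτ1 : 1 ≤ τ := by
    have h24 : 24 * Real.log K / M ≤ 1 / 2 := by
      rw [div_le_div_iff₀ hM0 (by norm_num)]; linarith
    nlinarith
  exact ⟨hearly, hlate, hτ1, hτ32, hcτeq⟩

/-- The window in the form `|τ - √2| ≤ 24 log K / M` (from `2 - x ≤ τ² ≤ 2 + y`, `τ ≥ 1`).
[cite: Tao2016AveragedNS, §5.5 (tcable)] -/
theorem abs_sub_sqrt_two_le {τ x y : ℝ} (hτ : 1 ≤ τ) (hx : 0 ≤ x) (hyx : y ≤ x)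
    (hlo : 2 - x ≤ τ ^ 2) (hhi : τ ^ 2 ≤ 2 + y) : |τ - sqrt 2| ≤ x := by
  have h72 := sqrt_two_gt
  have hs2 : sqrt 2 ^ 2 = 2 := sq_sqrt (by norm_num)
  have hsum : 2 ≤ τ + sqrt 2 := by linarith
  rw [abs_le]
  constructor
  · -- `√2 - τ = (2 - τ²)/(τ + √2) ≤ x/2`
    have : (sqrt 2 - τ) * (τ + sqrt 2) = 2 - τ ^ 2 := by nlinarith
    nlinarith
  · have : (τ - sqrt 2) * (τ + sqrt 2) = τ ^ 2 - 2 := by nlinarith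
    nlinarith

end CriticalTime

section PhaseTwo

/-! ## After the critical time: `b ≳ ε`, (c-large), (cgrow-2) -/

variable {K M ε τ δ : ℝ} {X : ℝ → Fin 5 → ℝ}

/-- `b ≥ ε/8` on `[τ,2]` ("`b(t) ≳ ε` for `t ∈ [t_c,2]`", from (bogo-2) at `t_c` and
`∂ₜb ≥ -4Mε³e^{18M} ≥ -ε/16`). [cite: Tao2016AveragedNS, §5.5 proof] -/
theorem b_lower_after (hX : ∀ t, HasDerivAt X (delayCircuitWith K M ε (X t)) t) (h0 : X 0 = delayInit)
    (hε : 0 < ε) (hε1 : ε ≤ 1) (hM0 : 0 < M) (hMK : M ≤ K ^ 10) (hK : 16 ≤ K) (hεK : ε ^ 2 ≤ 1 / (6 * K ^ 20))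
    (hεexp : ε ^ 2 ≤ exp (-(18 * M)) / (64 * M))
    (hτ1 : 1 ≤ τ) (hτ2 : τ ≤ 2)
    (hcτ : ∀ t, 0 ≤ t → t ≤ τ → X t 2 ≤ ε ^ 2 / K ^ 10)
    {t : ℝ} (ht : t ∈ Icc τ 2) : ε / 8 ≤ X t 1 := by
  have hK0 : 0 < K := by linarith
  have hK1 : 1 ≤ K := by linarith
  set k : ℝ := M with hk
  have hk0 : 0 < k := hM0
  -- `b(τ) ≥ ε/2`
  have hbτ : ε / 2 ≤ X τ 1 := by
    have hb := b_linear hX h0 hε hε1 hM0 hMK hK1 hτ2 hεK hcτ (t := τ) ⟨by linarith, le_rfl⟩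
    have h1 := (abs_le.1 hb).1
    have hK20 : 34 / K ^ 20 ≤ 1 / 2 := by
      rw [div_le_div_iff₀ (by positivity) (by norm_num)]
      have : (2 : ℝ) ^ 20 ≤ K ^ 20 := pow_le_pow_left₀ (by norm_num) (by linarith) 20
      nlinarith
    have h2 : 17 * ε / K ^ 20 * τ ≤ 34 / K ^ 20 * ε := by
      have : 17 * ε / K ^ 20 * τ ≤ 17 * ε / K ^ 20 * 2 :=
        mul_le_mul_of_nonneg_left hτ2 (by positivity)
      have h2e : 17 * ε / K ^ 20 * 2 = 34 / K ^ 20 * ε := by ring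
      linarith
    have h3 : 34 / K ^ 20 * ε ≤ 1 / 2 * ε := mul_le_mul_of_nonneg_right hK20 hε.le
    nlinarith
  -- `∂ₜb ≥ -ε/16` on `[τ,2]`
  have hmono := monotoneOn_sub_of_le_deriv (φ := fun _ => -(ε / 16))
    (Φ := fun s => -(ε / 16) * s) (convex_Icc τ 2) (fun s _ => hasDerivAt_b hX s)
    (fun s _ => ((hasDerivAt_id s).const_mul (-(ε / 16))).congr_deriv (by simp))
    (fun s hs => by
      have hs02 : s ∈ Icc (0 : ℝ) 2 := ⟨by linarith [hs.1], hs.2⟩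
      have hc0 : 0 ≤ X s 2 := c_nonneg hX h0 hs02.1
      have hcc : X s 2 ≤ 2 * ε ^ 2 * exp ((5 * s - 1) * k) := c_crude hX h0 hε hε1 hM0.le hs02
      have hc9 : X s 2 ≤ 2 * ε ^ 2 * exp (9 * k) := by
        refine hcc.trans (mul_le_mul_of_nonneg_left (exp_le_exp.2 ?_) (by positivity))
        simp only [hk]; nlinarith [hs.2]
      have hc2 : X s 2 ^ 2 ≤ (2 * ε ^ 2 * exp (9 * k)) ^ 2 := pow_le_pow_left₀ hc0 hc9 2
      -- `ν c² ≤ 4 k ε³ e^{18k} ≤ ε/16`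
      have hνc : ε⁻¹ * M * X s 2 ^ 2 ≤ ε / 16 := by
        have hε2 : ε ^ 2 * exp (18 * k) ≤ 1 / (64 * k) := by
          have := hεexp
          calc ε ^ 2 * exp (18 * k) ≤ exp (-(18 * k)) / (64 * k) * exp (18 * k) :=
                mul_le_mul_of_nonneg_right this (exp_pos _).le
            _ = 1 / (64 * k) := by
                rw [div_mul_eq_mul_div, mul_comm (exp _) (exp _), ← exp_add, add_neg_cancel,
                  exp_zero]
        calc ε⁻¹ * M * X s 2 ^ 2 ≤ ε⁻¹ * M * (2 * ε ^ 2 * exp (9 * k)) ^ 2 :=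
              mul_le_mul_of_nonneg_left hc2 (by positivity)
          _ = 4 * k * ε * (ε ^ 2 * exp (18 * k)) := by
              rw [show (18 : ℝ) * k = 9 * k + 9 * k by ring, exp_add]
              field_simp
              ring
          _ ≤ 4 * k * ε * (1 / (64 * k)) := mul_le_mul_of_nonneg_left hε2 (by positivity)
          _ = ε / 16 := by field_simp; ring
      have ha2 : 0 ≤ ε * X s 0 ^ 2 := by positivity
      linarith)
  have hτmem : τ ∈ Icc τ 2 := ⟨le_rfl, hτ2⟩
  have h := hmono hτmem ht ht.1
  simp only at h
  have : t - τ ≤ 1 := by linarith [ht.2]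
  nlinarith

/-- Exponential growth after `t_c`: `c(t) ≥ K⁻¹⁰ε² exp(M(t-τ)/8)` on `[τ,2]` (from
`∂ₜc ≥ νbc ≥ (M/8)c`). [cite: Tao2016AveragedNS, §5.5 (c-large)] -/
theorem c_growth (hX : ∀ t, HasDerivAt X (delayCircuitWith K M ε (X t)) t) (h0 : X 0 = delayInit)
    (hε : 0 < ε) (hε1 : ε ≤ 1) (hM0 : 0 < M) (hMK : M ≤ K ^ 10) (hK : 16 ≤ K) (hεK : ε ^ 2 ≤ 1 / (6 * K ^ 20))
    (hεexp : ε ^ 2 ≤ exp (-(18 * M)) / (64 * M))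
    (hτ1 : 1 ≤ τ) (hτ2 : τ ≤ 2)
    (hcτ : ∀ t, 0 ≤ t → t ≤ τ → X t 2 ≤ ε ^ 2 / K ^ 10) (hcτeq : X τ 2 = ε ^ 2 / K ^ 10)
    {t : ℝ} (ht : t ∈ Icc τ 2) :
    ε ^ 2 / K ^ 10 * exp (M * (t - τ) / 8) ≤ X t 2 := by
  have hK0 : 0 < K := by linarith
  set k : ℝ := M with hk
  have hk0 : 0 < k := hM0
  have hmono := monotoneOn_intFactor (s := Icc τ 2) (g := fun _ => k / 8)
    (G := fun s => k / 8 * s) (φ := fun _ => 0) (Φ := fun _ => 0) (convex_Icc τ 2)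
    (fun s _ => hasDerivAt_c hX s)
    (fun s _ => ((hasDerivAt_id s).const_mul (k / 8)).congr_deriv (by simp))
    (fun s _ => hasDerivAt_const s (0 : ℝ))
    (fun s hs => by
      have hc0 : 0 ≤ X s 2 := c_nonneg hX h0 (by linarith [hs.1])
      have hb : ε / 8 ≤ X s 1 := b_lower_after hX h0 hε hε1 hM0 hMK hK hεK hεexp hτ1 hτ2 hcτ hs
      have hνb : k / 8 ≤ ε⁻¹ * M * X s 1 := by
        calc k / 8 = ε⁻¹ * M * (ε / 8) := by simp only [hk]; field_simp
          _ ≤ ε⁻¹ * M * X s 1 := mul_le_mul_of_nonneg_left hb (by positivity)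
      have h1 : k / 8 * X s 2 ≤ ε⁻¹ * M * X s 1 * X s 2 :=
        mul_le_mul_of_nonneg_right hνb hc0
      have h2 : 0 ≤ ε ^ 2 * exp (-M) * X s 0 ^ 2 := by positivity
      have : 0 ≤ ε ^ 2 * exp (-M) * X s 0 ^ 2 + ε⁻¹ * M * X s 1 * X s 2
          - k / 8 * X s 2 := by linarith
      exact mul_nonneg this (exp_pos _).le)
  have hτmem : τ ∈ Icc τ 2 := ⟨le_rfl, hτ2⟩
  have h := hmono hτmem ht ht.1
  simp only [sub_zero, hcτeq] at h
  have hE : X t 2 = X t 2 * exp (-(k / 8 * t)) * exp (k / 8 * t) := by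
    rw [mul_assoc, ← exp_add, neg_add_cancel, exp_zero, mul_one]
  rw [hE]
  calc ε ^ 2 / K ^ 10 * exp (k * (t - τ) / 8)
      = ε ^ 2 / K ^ 10 * exp (-(k / 8 * τ)) * exp (k / 8 * t) := by
        rw [mul_assoc, ← exp_add]; congr 2; simp only [hk]; ring
    _ ≤ X t 2 * exp (-(k / 8 * t)) * exp (k / 8 * t) :=
        mul_le_mul_of_nonneg_right h (exp_pos _).le

/-- (c-large): `c ≥ K¹⁰⁰ε²` on `I = [τ + δ, 2]` for any onset delay `δ ≥ 0` with
`e^{Mδ/8} ≥ K¹¹⁰` (Tao, `M = K¹⁰`: `δ = K⁻⁹` via `e^{K/8} ≥ K¹¹⁰`; for the family `δ = 880 log K / M`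
exactly): "the rotor gate will be continuously and strongly activated from time `t_c + δ` onwards".
[cite: Tao2016AveragedNS, §5.5 (c-large)] -/
theorem c_large (hX : ∀ t, HasDerivAt X (delayCircuitWith K M ε (X t)) t) (h0 : X 0 = delayInit)
    (hε : 0 < ε) (hε1 : ε ≤ 1) (hM0 : 0 < M) (hMK : M ≤ K ^ 10) (hK : 16 ≤ K) (hεK : ε ^ 2 ≤ 1 / (6 * K ^ 20))
    (hεexp : ε ^ 2 ≤ exp (-(18 * M)) / (64 * M)) (hδ : 0 ≤ δ) (hon : K ^ 110 ≤ exp (M * δ / 8))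
    (hτ1 : 1 ≤ τ) (hτ2 : τ ≤ 2)
    (hcτ : ∀ t, 0 ≤ t → t ≤ τ → X t 2 ≤ ε ^ 2 / K ^ 10) (hcτeq : X τ 2 = ε ^ 2 / K ^ 10)
    {t : ℝ} (ht : t ∈ Icc (τ + δ) 2) : K ^ 100 * ε ^ 2 ≤ X t 2 := by
  have hK0 : 0 < K := by linarith
  have ht' : t ∈ Icc τ 2 := ⟨by linarith [ht.1], ht.2⟩
  have hg := c_growth hX h0 hε hε1 hM0 hMK hK hεK hεexp hτ1 hτ2 hcτ hcτeq ht'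
  have hexp : M * δ / 8 ≤ M * (t - τ) / 8 := by
    have h1 : δ ≤ t - τ := by linarith [ht.1]
    have h2 : M * δ ≤ M * (t - τ) := mul_le_mul_of_nonneg_left h1 hM0.le
    linarith
  calc K ^ 100 * ε ^ 2 = ε ^ 2 / K ^ 10 * K ^ 110 := by field_simp
    _ ≤ ε ^ 2 / K ^ 10 * exp (M * δ / 8) := mul_le_mul_of_nonneg_left hon (by positivity)
    _ ≤ ε ^ 2 / K ^ 10 * exp (M * (t - τ) / 8) :=
        mul_le_mul_of_nonneg_left (exp_le_exp.2 hexp) (by positivity)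
    _ ≤ X t 2 := hg

/-- (cgrow-2): on `I`, `0 ≤ ∂ₜc ≤ 6K¹⁰c`. [cite: Tao2016AveragedNS, §5.5 (cgrow-2)] -/
theorem c_deriv_bounds (hX : ∀ t, HasDerivAt X (delayCircuitWith K M ε (X t)) t) (h0 : X 0 = delayInit)
    (hε : 0 < ε) (hε1 : ε ≤ 1) (hM0 : 0 < M) (hMK : M ≤ K ^ 10) (hK : 16 ≤ K) (hεK : ε ^ 2 ≤ 1 / (6 * K ^ 20))
    (hεexp : ε ^ 2 ≤ exp (-(18 * M)) / (64 * M)) (hδ : 0 ≤ δ) (hon : K ^ 110 ≤ exp (M * δ / 8))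
    (hτ1 : 1 ≤ τ) (hτ2 : τ ≤ 2)
    (hcτ : ∀ t, 0 ≤ t → t ≤ τ → X t 2 ≤ ε ^ 2 / K ^ 10) (hcτeq : X τ 2 = ε ^ 2 / K ^ 10)
    {t : ℝ} (ht : t ∈ Icc (τ + δ) 2) :
    0 ≤ ε ^ 2 * exp (-M) * X t 0 ^ 2 + ε⁻¹ * M * X t 1 * X t 2 ∧
      ε ^ 2 * exp (-M) * X t 0 ^ 2 + ε⁻¹ * M * X t 1 * X t 2 ≤ 6 * K ^ 10 * X t 2 := by
  have hK0 : 0 < K := by linarith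
  have ht' : t ∈ Icc τ 2 := ⟨by linarith [ht.1], ht.2⟩
  have ht02 : t ∈ Icc (0 : ℝ) 2 := ⟨by linarith [ht'.1], ht.2⟩
  have hc0 : 0 ≤ X t 2 := c_nonneg hX h0 ht02.1
  have hcl : K ^ 100 * ε ^ 2 ≤ X t 2 := c_large hX h0 hε hε1 hM0 hMK hK hεK hεexp hδ hon hτ1 hτ2 hcτ hcτeq ht
  have hb : ε / 8 ≤ X t 1 := b_lower_after hX h0 hε hε1 hM0 hMK hK hεK hεexp hτ1 hτ2 hcτ ht'
  have hb5 : |X t 1| ≤ 5 * ε := (bc_small hX h0 hε hε1 hM0.le ht02).1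
  have ha : X t 0 ^ 2 ≤ 1 := traj_sq_le_one hX h0 t 0
  constructor
  · have h1 : 0 ≤ ε⁻¹ * M * X t 1 * X t 2 := by
      have : 0 ≤ X t 1 := by linarith [hε.le]
      have := hM0.le
      positivity
    have := hM0.le
    positivity
  · -- `μ a² ≤ ε² ≤ K¹⁰⁰ ε² ≤ c ≤ K¹⁰ c` and `ν b c ≤ 5 K¹⁰ c`
    have hek : exp (-M) ≤ 1 := by rw [exp_le_one_iff, neg_nonpos]; exact hM0.le
    have h1 : ε ^ 2 * exp (-M) * X t 0 ^ 2 ≤ K ^ 10 * X t 2 := by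
      calc ε ^ 2 * exp (-M) * X t 0 ^ 2 ≤ ε ^ 2 * 1 * 1 :=
            mul_le_mul (mul_le_mul_of_nonneg_left hek (by positivity)) ha (by positivity)
              (by positivity)
        _ ≤ K ^ 100 * ε ^ 2 := by
            have : (1 : ℝ) ≤ K ^ 100 := one_le_pow₀ (by linarith)
            nlinarith [pow_pos hε 2]
        _ ≤ X t 2 := hcl
        _ ≤ K ^ 10 * X t 2 := by
            have : (1 : ℝ) ≤ K ^ 10 := one_le_pow₀ (by linarith)
            nlinarith
    have h2 : ε⁻¹ * M * X t 1 * X t 2 ≤ 5 * K ^ 10 * X t 2 := by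
      have hb' : X t 1 ≤ 5 * ε := (le_abs_self _).trans hb5
      have h5 : ε⁻¹ * X t 1 ≤ 5 := by rw [inv_mul_le_iff₀ hε]; linarith
      have : ε⁻¹ * M * X t 1 * X t 2 = (ε⁻¹ * X t 1) * (M * X t 2) := by ring
      rw [this]
      have hkc : 0 ≤ M * X t 2 := mul_nonneg hM0.le hc0
      have hMc : M * X t 2 ≤ K ^ 10 * X t 2 := mul_le_mul_of_nonneg_right hMK hc0
      nlinarith
    linarith

/-! ## Equipartition: the corrector `V = a d ε²/c` and (douse) -/

/-- The equipartition corrector `V = a·d·ε²/c` has `∂ₜV = (a² - d²) + R` with the explicit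
remainder `R = -(εabd + μacd + Kadã)ε²/c - ad(ε²/c)(∂ₜc/c)` (product rule; the rotor terms give
exactly `ε⁻²c·(a²-d²)·ε²/c = a² - d²`). [cite: Tao2016AveragedNS, §5.5 (douse)] -/
theorem hasDerivAt_V (hX : ∀ t, HasDerivAt X (delayCircuitWith K M ε (X t)) t) (hε : ε ≠ 0)
    {t : ℝ} (hc : X t 2 ≠ 0) :
    HasDerivAt (fun s => X s 0 * X s 3 * (ε ^ 2 * (X s 2)⁻¹))
      ((X t 0 ^ 2 - X t 3 ^ 2) +
        (-(ε * X t 0 * X t 1 * X t 3 + ε ^ 2 * exp (-M) * X t 0 * X t 2 * X t 3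
            + K * X t 0 * X t 3 * X t 4) * (ε ^ 2 * (X t 2)⁻¹)
          - X t 0 * X t 3 * (ε ^ 2 * (X t 2)⁻¹) *
            ((ε ^ 2 * exp (-M) * X t 0 ^ 2 + ε⁻¹ * M * X t 1 * X t 2) * (X t 2)⁻¹))) t := by
  have h1 := (hasDerivAt_a hX t).fun_mul (hasDerivAt_d hX t)
  have h2 := ((hasDerivAt_c hX t).fun_inv hc).const_mul (ε ^ 2)
  refine (h1.fun_mul h2).congr_deriv ?_
  field_simp
  ring

/-- Size of the remainder in `∂ₜV` on `I`: `|R| ≤ 9K⁻⁹⁰` (uses `ε²/c ≤ K⁻¹⁰⁰`, `0 ≤ ∂ₜc ≤ 6K¹⁰c`,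
all modes `O(1)`). [cite: Tao2016AveragedNS, §5.5 (douse)] -/
theorem V_remainder_le (hX : ∀ t, HasDerivAt X (delayCircuitWith K M ε (X t)) t) (h0 : X 0 = delayInit)
    (hε : 0 < ε) (hε1 : ε ≤ 1) (hM0 : 0 < M) (hMK : M ≤ K ^ 10) (hK : 16 ≤ K) (hεK : ε ^ 2 ≤ 1 / (6 * K ^ 20))
    (hεexp : ε ^ 2 ≤ exp (-(18 * M)) / (64 * M)) (hδ : 0 ≤ δ) (hon : K ^ 110 ≤ exp (M * δ / 8))
    (hτ1 : 1 ≤ τ) (hτ2 : τ ≤ 2)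
    (hcτ : ∀ t, 0 ≤ t → t ≤ τ → X t 2 ≤ ε ^ 2 / K ^ 10) (hcτeq : X τ 2 = ε ^ 2 / K ^ 10)
    {t : ℝ} (ht : t ∈ Icc (τ + δ) 2) :
    |(-(ε * X t 0 * X t 1 * X t 3 + ε ^ 2 * exp (-M) * X t 0 * X t 2 * X t 3
            + K * X t 0 * X t 3 * X t 4) * (ε ^ 2 * (X t 2)⁻¹)
          - X t 0 * X t 3 * (ε ^ 2 * (X t 2)⁻¹) *
            ((ε ^ 2 * exp (-M) * X t 0 ^ 2 + ε⁻¹ * M * X t 1 * X t 2) * (X t 2)⁻¹))|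
      ≤ 9 / K ^ 90 := by
  have hK0 : 0 < K := by linarith
  have hK1 : 1 ≤ K := by linarith
  have hcl : K ^ 100 * ε ^ 2 ≤ X t 2 := c_large hX h0 hε hε1 hM0 hMK hK hεK hεexp hδ hon hτ1 hτ2 hcτ hcτeq ht
  have hcpos : 0 < X t 2 := lt_of_lt_of_le (by positivity) hcl
  obtain ⟨hc'0, hc'6⟩ := c_deriv_bounds hX h0 hε hε1 hM0 hMK hK hεK hεexp hδ hon hτ1 hτ2 hcτ hcτeq ht
  set q : ℝ := ε ^ 2 * (X t 2)⁻¹ with hq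
  have hq0 : 0 ≤ q := by positivity
  have hq1 : q ≤ 1 / K ^ 100 := by
    simp only [hq]
    rw [← div_eq_mul_inv, div_le_div_iff₀ hcpos (by positivity), one_mul]
    linarith
  set c' : ℝ := ε ^ 2 * exp (-M) * X t 0 ^ 2 + ε⁻¹ * M * X t 1 * X t 2 with hc'
  have hrat0 : 0 ≤ c' * (X t 2)⁻¹ := by positivity
  have hrat : c' * (X t 2)⁻¹ ≤ 6 * K ^ 10 := by
    rw [← div_eq_mul_inv, div_le_iff₀ hcpos]; exact hc'6
  have ha : |X t 0| ≤ 1 := traj_abs_le_one hX h0 t 0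
  have hb : |X t 1| ≤ 1 := traj_abs_le_one hX h0 t 1
  have hc : |X t 2| ≤ 1 := traj_abs_le_one hX h0 t 2
  have hd : |X t 3| ≤ 1 := traj_abs_le_one hX h0 t 3
  have he : |X t 4| ≤ 1 := traj_abs_le_one hX h0 t 4
  have hμ1 : ε ^ 2 * exp (-M) ≤ 1 := by
    have hek : exp (-M) ≤ 1 := by rw [exp_le_one_iff, neg_nonpos]; exact hM0.le
    calc ε ^ 2 * exp (-M) ≤ 1 ^ 2 * 1 :=
          mul_le_mul (pow_le_pow_left₀ hε.le hε1 2) hek (exp_pos _).le (by positivity)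
      _ = 1 := by ring
  -- term 1
  have hT1 : |(-(ε * X t 0 * X t 1 * X t 3 + ε ^ 2 * exp (-M) * X t 0 * X t 2 * X t 3
      + K * X t 0 * X t 3 * X t 4) * q)| ≤ (2 + K) * (1 / K ^ 100) := by
    rw [abs_mul, abs_neg, abs_of_nonneg hq0]
    have hin : |ε * X t 0 * X t 1 * X t 3 + ε ^ 2 * exp (-M) * X t 0 * X t 2 * X t 3
        + K * X t 0 * X t 3 * X t 4| ≤ 2 + K := by
      have e1 : |ε * X t 0 * X t 1 * X t 3| ≤ 1 := by
        rw [abs_mul, abs_mul, abs_mul, abs_of_pos hε]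
        calc ε * |X t 0| * |X t 1| * |X t 3| ≤ 1 * 1 * 1 * 1 := by
              gcongr
          _ = 1 := by ring
      have e2 : |ε ^ 2 * exp (-M) * X t 0 * X t 2 * X t 3| ≤ 1 := by
        rw [abs_mul, abs_mul, abs_mul, abs_of_nonneg (by positivity : 0 ≤ ε ^ 2 * exp (-M))]
        calc ε ^ 2 * exp (-M) * |X t 0| * |X t 2| * |X t 3| ≤ 1 * 1 * 1 * 1 := by
              gcongr
          _ = 1 := by ring
      have e3 : |K * X t 0 * X t 3 * X t 4| ≤ K := by
        rw [abs_mul, abs_mul, abs_mul, abs_of_pos hK0]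
        calc K * |X t 0| * |X t 3| * |X t 4| ≤ K * 1 * 1 * 1 := by gcongr
          _ = K := by ring
      calc _ ≤ |ε * X t 0 * X t 1 * X t 3 + ε ^ 2 * exp (-M) * X t 0 * X t 2 * X t 3|
            + |K * X t 0 * X t 3 * X t 4| := abs_add_le _ _
        _ ≤ |ε * X t 0 * X t 1 * X t 3| + |ε ^ 2 * exp (-M) * X t 0 * X t 2 * X t 3|
            + |K * X t 0 * X t 3 * X t 4| := by
            have := abs_add_le (ε * X t 0 * X t 1 * X t 3)
              (ε ^ 2 * exp (-M) * X t 0 * X t 2 * X t 3)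
            linarith
        _ ≤ 2 + K := by linarith
    exact mul_le_mul hin hq1 hq0 (by positivity)
  -- term 2
  have hT2 : |X t 0 * X t 3 * q * (c' * (X t 2)⁻¹)| ≤ 6 * K ^ 10 * (1 / K ^ 100) := by
    rw [abs_mul, abs_mul, abs_mul, abs_of_nonneg hq0, abs_of_nonneg hrat0]
    calc |X t 0| * |X t 3| * q * (c' * (X t 2)⁻¹) ≤ 1 * 1 * (1 / K ^ 100) * (6 * K ^ 10) := by
          gcongr
      _ = 6 * K ^ 10 * (1 / K ^ 100) := by ring
  have hsum : (2 + K) * (1 / K ^ 100) + 6 * K ^ 10 * (1 / K ^ 100) ≤ 9 / K ^ 90 := by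
    have h10 : 2 + K ≤ 3 * K ^ 10 := by
      have : K ≤ K ^ 10 := le_self_pow₀ hK1 (by norm_num)
      linarith
    rw [show 9 / K ^ 90 = 9 * K ^ 10 * (1 / K ^ 100) by field_simp]
    have : 0 ≤ 1 / K ^ 100 := by positivity
    nlinarith
  calc _ ≤ |(-(ε * X t 0 * X t 1 * X t 3 + ε ^ 2 * exp (-M) * X t 0 * X t 2 * X t 3
        + K * X t 0 * X t 3 * X t 4) * q)| + |X t 0 * X t 3 * q * (c' * (X t 2)⁻¹)| :=
        abs_sub _ _
    _ ≤ (2 + K) * (1 / K ^ 100) + 6 * K ^ 10 * (1 / K ^ 100) := add_le_add hT1 hT2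
    _ ≤ 9 / K ^ 90 := hsum

end PhaseTwo


section PhaseThree

/-! ## The claim (atc): `ã(t_c + 1/K) ≥ 1/10` -/

variable {K M ε τ δ : ℝ} {X : ℝ → Fin 5 → ℝ}

/-- **(atc)** with onset `σ = t_c + δ`: `ã(σ + 1/K) ≥ 1/10`. If not, on `J = [σ, σ + 1/K]` one has
`ã ≤ 1/10`, hence `a² + d² ≥ 0.98`, while `Ψ = V + 2ã/K` has `∂ₜΨ = a² + d² + O(K⁻⁹⁰)` and total
variation `≤ 2K⁻¹⁰⁰ + 0.2/K` over `J` — a contradiction. [cite: Tao2016AveragedNS, §5.5 (atc)] -/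
theorem e_tenth (hX : ∀ t, HasDerivAt X (delayCircuitWith K M ε (X t)) t) (h0 : X 0 = delayInit)
    (hε : 0 < ε) (hε1 : ε ≤ 1) (hM0 : 0 < M) (hMK : M ≤ K ^ 10) (hK : 16 ≤ K) (hεK : ε ^ 2 ≤ 1 / (6 * K ^ 20))
    (hεexp : ε ^ 2 ≤ exp (-(18 * M)) / (64 * M)) (hδ : 0 ≤ δ) (hon : K ^ 110 ≤ exp (M * δ / 8))
    (hτ1 : 1 ≤ τ) (hfit : τ + δ + (sqrt K)⁻¹ ≤ 2)
    (hcτ : ∀ t, 0 ≤ t → t ≤ τ → X t 2 ≤ ε ^ 2 / K ^ 10) (hcτeq : X τ 2 = ε ^ 2 / K ^ 10) :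
    1 / 10 ≤ X (τ + δ + K⁻¹) 4 := by
  have hK0 : 0 < K := by linarith
  have hK1 : 1 ≤ K := by linarith
  have hsK : K⁻¹ ≤ (sqrt K)⁻¹ := by
    rw [inv_le_inv₀ hK0 (by positivity)]
    calc sqrt K ≤ sqrt K * sqrt K :=
          le_mul_of_one_le_right (by positivity) (by linarith [(invSqrt_facts hK).2.2.2.1])
      _ = K := mul_self_sqrt hK0.le
  have hu0' : 0 < K⁻¹ := inv_pos.2 hK0
  have hτ2 : τ ≤ 2 := by linarith
  have ht12' : τ + δ + K⁻¹ ≤ 2 := by linarith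
  set t₀ : ℝ := τ + δ with ht₀
  set t₁ : ℝ := τ + δ + K⁻¹ with ht₁
  have ht₀0 : 0 ≤ t₀ := by simp only [ht₀]; linarith
  have hKinv : K⁻¹ ≤ 1 / 16 := by rw [inv_le_comm₀ hK0 (by norm_num)]; linarith
  have h01 : t₀ ≤ t₁ := by simp only [ht₀, ht₁]; linarith
  have ht12 : t₁ ≤ 2 := by simp only [ht₁]; linarith
  have hJI : ∀ s ∈ Icc t₀ t₁, s ∈ Icc (τ + δ) 2 := fun s hs => ⟨hs.1, hs.2.trans ht12⟩
  -- numeric facts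
  have hK20 : (2 : ℝ) ^ 20 ≤ K ^ 20 := pow_le_pow_left₀ (by norm_num) (by linarith) 20
  have hK90 : (2 : ℝ) ^ 90 ≤ K ^ 90 := pow_le_pow_left₀ (by norm_num) (by linarith) 90
  have hε2 : (5 * ε) ^ 2 ≤ 1 / 1000 := by
    have h6 : 1 / (6 * K ^ 20) ≤ 1 / 25000 := by
      apply one_div_le_one_div_of_le (by norm_num); linarith
    have : (5 * ε) ^ 2 = 25 * ε ^ 2 := by ring
    rw [this]; linarith
  have hK90' : 9 / K ^ 90 ≤ 1 / 1000 := by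
    rw [div_le_div_iff₀ (by positivity) (by norm_num)]; linarith
  by_contra hlt'
  have hlt := not_le.1 hlt'
  have hmonoE := delayCircuitWith_output_monotone hK0.le hX
  -- `Ψ = V + (2/K) ã` has derivative `≥ 0.97` on `J`
  have hmono := monotoneOn_sub_of_le_deriv (φ := fun _ => (97 : ℝ) / 100)
    (Φ := fun s => 97 / 100 * s) (convex_Icc t₀ t₁)
    (f := fun s => X s 0 * X s 3 * (ε ^ 2 * (X s 2)⁻¹) + 2 / K * X s 4)
    (fun s hs => by
      have hsI := hJI s hs
      have hcl : K ^ 100 * ε ^ 2 ≤ X s 2 :=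
        c_large hX h0 hε hε1 hM0 hMK hK hεK hεexp hδ hon hτ1 hτ2 hcτ hcτeq hsI
      have hcne : X s 2 ≠ 0 := (lt_of_lt_of_le (by positivity) hcl).ne'
      exact (hasDerivAt_V hX hε.ne' hcne).add ((hasDerivAt_e hX s).const_mul (2 / K)))
    (fun s _ => ((hasDerivAt_id s).const_mul ((97 : ℝ) / 100)).congr_deriv (by simp))
    (fun s hs => by
      have hsI := hJI s hs
      have hs02 : s ∈ Icc (0 : ℝ) 2 := ⟨by linarith [hs.1, ht₀0], hsI.2⟩
      have hR := V_remainder_le hX h0 hε hε1 hM0 hMK hK hεK hεexp hδ hon hτ1 hτ2 hcτ hcτeq hsI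
      have hRlo := (abs_le.1 hR).1
      have hsum := traj_sum_sq_eq_one hX h0 s
      obtain ⟨hb5, hc5⟩ := bc_small hX h0 hε hε1 hM0.le hs02
      have hb2 : X s 1 ^ 2 ≤ (5 * ε) ^ 2 := by
        rw [← sq_abs]; exact pow_le_pow_left₀ (abs_nonneg _) hb5 2
      have hc2 : X s 2 ^ 2 ≤ (5 * ε) ^ 2 := by
        rw [← sq_abs]; exact pow_le_pow_left₀ (abs_nonneg _) hc5 2
      have hes : X s 4 ≤ 1 / 10 := (hmonoE hs.2).trans hlt.le
      have hes0 : 0 ≤ X s 4 := e_nonneg hX h0 hK0.le hs02.1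
      have he2 : X s 4 ^ 2 ≤ 1 / 100 := by
        have := pow_le_pow_left₀ hes0 hes 2; norm_num at this; exact this
      have hKd : 2 / K * (K * X s 3 ^ 2) = 2 * X s 3 ^ 2 := by field_simp
      rw [hKd]
      linarith)
  have hmem0 : t₀ ∈ Icc t₀ t₁ := ⟨le_rfl, h01⟩
  have hmem1 : t₁ ∈ Icc t₀ t₁ := ⟨h01, le_rfl⟩
  have h := hmono hmem0 hmem1 h01
  simp only at h
  -- sizes of `V` at the endpoints and of `ã`
  have hV : ∀ s ∈ Icc t₀ t₁, |X s 0 * X s 3 * (ε ^ 2 * (X s 2)⁻¹)| ≤ 1 / K ^ 100 := by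
    intro s hs
    have hsI := hJI s hs
    have hcl : K ^ 100 * ε ^ 2 ≤ X s 2 :=
      c_large hX h0 hε hε1 hM0 hMK hK hεK hεexp hδ hon hτ1 hτ2 hcτ hcτeq hsI
    have hcpos : 0 < X s 2 := lt_of_lt_of_le (by positivity) hcl
    have hq0 : 0 ≤ ε ^ 2 * (X s 2)⁻¹ := by positivity
    have hq : ε ^ 2 * (X s 2)⁻¹ ≤ 1 / K ^ 100 := by
      rw [← div_eq_mul_inv, div_le_div_iff₀ hcpos (by positivity), one_mul]; linarith
    rw [abs_mul, abs_mul, abs_of_nonneg hq0]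
    calc |X s 0| * |X s 3| * (ε ^ 2 * (X s 2)⁻¹) ≤ 1 * 1 * (1 / K ^ 100) :=
          mul_le_mul (mul_le_mul (traj_abs_le_one hX h0 s 0) (traj_abs_le_one hX h0 s 3) (abs_nonneg _)
            zero_le_one) hq hq0 (by norm_num)
      _ = 1 / K ^ 100 := by ring
  have hV0 := (abs_le.1 (hV t₀ hmem0)).1
  have hV1 := (abs_le.1 (hV t₁ hmem1)).2
  have he0 : 0 ≤ X t₀ 4 := e_nonneg hX h0 hK0.le ht₀0
  have hlen : t₁ - t₀ = K⁻¹ := by simp only [ht₀, ht₁]; ring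
  -- numeric contradiction, in the variable `u = 1/K`
  set u : ℝ := K⁻¹ with hu
  have hu0 : 0 < u := by positivity
  have hK8 : (2 : ℝ) ^ 8 ≤ K ^ 8 := pow_le_pow_left₀ (by norm_num) (by linarith) 8
  have hK99 : (2 : ℝ) ^ 8 ≤ K ^ 99 := hK8.trans (pow_le_pow_right₀ hK1 (by norm_num))
  have hi99 : (K ^ 99)⁻¹ ≤ 1 / 256 := by
    rw [one_div, inv_le_inv₀ (by positivity) (by norm_num)]; linarith
  have h100 : 1 / K ^ 100 ≤ u * (1 / 256) := by
    rw [show 1 / K ^ 100 = u * (K ^ 99)⁻¹ by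
      simp only [hu]; rw [← mul_inv, ← pow_succ', one_div]]
    exact mul_le_mul_of_nonneg_left hi99 hu0.le
  have hKu : 2 / K * X t₁ 4 - 2 / K * X t₀ 4 ≤ 2 * u * (1 / 10) := by
    have : 2 / K * X t₁ 4 - 2 / K * X t₀ 4 = 2 * u * (X t₁ 4 - X t₀ 4) := by
      simp only [hu]; ring
    rw [this]
    exact mul_le_mul_of_nonneg_left (by linarith) (by positivity)
  have hfin : 97 / 100 * (t₁ - t₀) ≤ 2 * (u * (1 / 256)) + 2 * u * (1 / 10) := by linarith
  rw [hlen] at hfin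
  linarith

/-! ## Equipartition energy `E_*` and its decay (toke) -/

/-- Derivative of the modified energy `E_* = ½(1-ã²) - ½K·(adε²/c)·ã` (`= ½(a²+b²+c²+d²) - …` by
(energy-con)): `∂ₜE_* = -½Kã(a²+d²) - ½K·R·ã - ½K²·V·d²`, with `R` the remainder of `∂ₜV`.
[cite: Tao2016AveragedNS, §5.5 (proof of (beable))] -/
theorem hasDerivAt_Es (hX : ∀ t, HasDerivAt X (delayCircuitWith K M ε (X t)) t) (hε : ε ≠ 0)
    {t : ℝ} (hc : X t 2 ≠ 0) :
    HasDerivAt (fun s => (1 - X s 4 * X s 4) / 2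
        - K / 2 * (X s 0 * X s 3 * (ε ^ 2 * (X s 2)⁻¹) * X s 4))
      (-(K / 2) * X t 4 * (X t 0 ^ 2 + X t 3 ^ 2)
        - K / 2 * ((-(ε * X t 0 * X t 1 * X t 3 + ε ^ 2 * exp (-M) * X t 0 * X t 2 * X t 3
            + K * X t 0 * X t 3 * X t 4) * (ε ^ 2 * (X t 2)⁻¹)
          - X t 0 * X t 3 * (ε ^ 2 * (X t 2)⁻¹) *
            ((ε ^ 2 * exp (-M) * X t 0 ^ 2 + ε⁻¹ * M * X t 1 * X t 2) * (X t 2)⁻¹)))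
          * X t 4
        - K ^ 2 / 2 * (X t 0 * X t 3 * (ε ^ 2 * (X t 2)⁻¹)) * X t 3 ^ 2) t := by
  have hEE := ((hasDerivAt_e hX t).fun_mul (hasDerivAt_e hX t)).const_sub 1 |>.div_const 2
  have hVE := ((hasDerivAt_V hX hε hc).fun_mul (hasDerivAt_e hX t)).const_mul (K / 2)
  refine (hEE.fun_sub hVE).congr_deriv ?_
  ring

/-- Dissipation inequality for `E_*` on `[t', 2]`, `t' = t_c + 1/K`:
`∂ₜE_* + Kã(t')E_* ≤ 7K⁻⁸⁹`. [cite: Tao2016AveragedNS, §5.5 (proof of (beable))] -/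
theorem Es_dissipation (hX : ∀ t, HasDerivAt X (delayCircuitWith K M ε (X t)) t) (h0 : X 0 = delayInit)
    (hε : 0 < ε) (hε1 : ε ≤ 1) (hM0 : 0 < M) (hMK : M ≤ K ^ 10) (hK : 16 ≤ K) (hεK : ε ^ 2 ≤ 1 / (6 * K ^ 20))
    (hε100 : ε ≤ 1 / K ^ 100)
    (hεexp : ε ^ 2 ≤ exp (-(18 * M)) / (64 * M)) (hδ : 0 ≤ δ) (hon : K ^ 110 ≤ exp (M * δ / 8))
    (hτ1 : 1 ≤ τ) (hfit : τ + δ + (sqrt K)⁻¹ ≤ 2)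
    (hcτ : ∀ t, 0 ≤ t → t ≤ τ → X t 2 ≤ ε ^ 2 / K ^ 10) (hcτeq : X τ 2 = ε ^ 2 / K ^ 10)
    {s : ℝ} (hs : s ∈ Icc (τ + δ + K⁻¹) 2) :
    (-(K / 2) * X s 4 * (X s 0 ^ 2 + X s 3 ^ 2)
        - K / 2 * ((-(ε * X s 0 * X s 1 * X s 3 + ε ^ 2 * exp (-M) * X s 0 * X s 2 * X s 3
            + K * X s 0 * X s 3 * X s 4) * (ε ^ 2 * (X s 2)⁻¹)
          - X s 0 * X s 3 * (ε ^ 2 * (X s 2)⁻¹) *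
            ((ε ^ 2 * exp (-M) * X s 0 ^ 2 + ε⁻¹ * M * X s 1 * X s 2) * (X s 2)⁻¹)))
          * X s 4
        - K ^ 2 / 2 * (X s 0 * X s 3 * (ε ^ 2 * (X s 2)⁻¹)) * X s 3 ^ 2)
      + K * X (τ + δ + K⁻¹) 4 * ((1 - X s 4 * X s 4) / 2
        - K / 2 * (X s 0 * X s 3 * (ε ^ 2 * (X s 2)⁻¹) * X s 4)) ≤ 7 / K ^ 89 := by
  have hK0 : 0 < K := by linarith
  have hK1 : 1 ≤ K := by linarith
  have hτ2 : τ ≤ 2 := by linarith [inv_nonneg.2 (sqrt_nonneg K)]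
  have hu0' : 0 < K⁻¹ := inv_pos.2 hK0
  have hsI : s ∈ Icc (τ + δ) 2 := ⟨by linarith [hs.1], hs.2⟩
  have hs02 : s ∈ Icc (0 : ℝ) 2 := ⟨by linarith [hs.1], hs.2⟩
  have hcl : K ^ 100 * ε ^ 2 ≤ X s 2 := c_large hX h0 hε hε1 hM0 hMK hK hεK hεexp hδ hon hτ1 hτ2 hcτ hcτeq hsI
  have hcpos : 0 < X s 2 := lt_of_lt_of_le (by positivity) hcl
  have hq0 : 0 ≤ ε ^ 2 * (X s 2)⁻¹ := by positivity
  have hq1 : ε ^ 2 * (X s 2)⁻¹ ≤ 1 / K ^ 100 := by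
    rw [← div_eq_mul_inv, div_le_div_iff₀ hcpos (by positivity), one_mul]; linarith
  obtain ⟨hb5, hc5⟩ := bc_small hX h0 hε hε1 hM0.le hs02
  have hb2 : X s 1 ^ 2 ≤ (5 * ε) ^ 2 := by
    rw [← sq_abs]; exact pow_le_pow_left₀ (abs_nonneg _) hb5 2
  have hc2 : X s 2 ^ 2 ≤ (5 * ε) ^ 2 := by
    rw [← sq_abs]; exact pow_le_pow_left₀ (abs_nonneg _) hc5 2
  have hmonoE := delayCircuitWith_output_monotone hK0.le hX
  exact Es_alg hK (traj_sum_sq_eq_one hX h0 s) hq0 hq1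
    (V_remainder_le hX h0 hε hε1 hM0 hMK hK hεK hεexp hδ hon hτ1 hτ2 hcτ hcτeq hsI)
    (traj_abs_le_one hX h0 s 0) (traj_abs_le_one hX h0 s 3) (traj_abs_le_one hX h0 s 4)
    (e_nonneg hX h0 hK0.le (by linarith))
    ((le_abs_self _).trans (traj_abs_le_one hX h0 _ 4)) (hmonoE hs.1) hb2 hc2 hε hε1 hε100

end PhaseThree


section Decay

variable {K M ε τ δ : ℝ} {X : ℝ → Fin 5 → ℝ}

/-- On `I = [t_c + δ, 2]`: `|½K·V·ã| ≤ ½K⁻⁹⁹` (`V = adε²/c`, `ε²/c ≤ K⁻¹⁰⁰`).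
[cite: Tao2016AveragedNS, §5.5 (proof of (beable))] -/
theorem KVe_small (hX : ∀ t, HasDerivAt X (delayCircuitWith K M ε (X t)) t) (h0 : X 0 = delayInit)
    (hε : 0 < ε) (hε1 : ε ≤ 1) (hM0 : 0 < M) (hMK : M ≤ K ^ 10) (hK : 16 ≤ K) (hεK : ε ^ 2 ≤ 1 / (6 * K ^ 20))
    (hεexp : ε ^ 2 ≤ exp (-(18 * M)) / (64 * M)) (hδ : 0 ≤ δ) (hon : K ^ 110 ≤ exp (M * δ / 8))
    (hτ1 : 1 ≤ τ) (hτ2 : τ ≤ 2)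
    (hcτ : ∀ t, 0 ≤ t → t ≤ τ → X t 2 ≤ ε ^ 2 / K ^ 10) (hcτeq : X τ 2 = ε ^ 2 / K ^ 10)
    {s : ℝ} (hs : s ∈ Icc (τ + δ) 2) :
    |K / 2 * (X s 0 * X s 3 * (ε ^ 2 * (X s 2)⁻¹) * X s 4)| ≤ 1 / 2 / K ^ 99 := by
  have hK0 : 0 < K := by linarith
  have hcl : K ^ 100 * ε ^ 2 ≤ X s 2 :=
    c_large hX h0 hε hε1 hM0 hMK hK hεK hεexp hδ hon hτ1 hτ2 hcτ hcτeq hs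
  have hcpos : 0 < X s 2 := lt_of_lt_of_le (by positivity) hcl
  have hq0 : 0 ≤ ε ^ 2 * (X s 2)⁻¹ := by positivity
  have hq : ε ^ 2 * (X s 2)⁻¹ ≤ 1 / K ^ 100 := by
    rw [← div_eq_mul_inv, div_le_div_iff₀ hcpos (by positivity), one_mul]; linarith
  rw [abs_mul, abs_of_pos (by positivity : 0 < K / 2), abs_mul, abs_mul, abs_mul,
    abs_of_nonneg hq0]
  calc K / 2 * (|X s 0| * |X s 3| * (ε ^ 2 * (X s 2)⁻¹) * |X s 4|)
      ≤ K / 2 * (1 * 1 * (1 / K ^ 100) * 1) := by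
        refine mul_le_mul_of_nonneg_left ?_ (by positivity)
        exact mul_le_mul (mul_le_mul (mul_le_mul (traj_abs_le_one hX h0 s 0)
          (traj_abs_le_one hX h0 s 3) (abs_nonneg _) zero_le_one) hq hq0 (by norm_num))
          (traj_abs_le_one hX h0 s 4) (abs_nonneg _) (by positivity)
    _ = 1 / 2 / K ^ 99 := by field_simp

/-- **(toke)**: on `[σ + 1/√K, 2]` (`σ = t_c + δ`),
`E_*(t) ≤ e^{-Kã(t')(t-t')} + 7K⁻⁸⁹/(Kã(t')) ≤ e^{(1-√K)/10} + 70K⁻⁹⁰` (Grönwall from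
`t' = σ + 1/K`, `ã(t') ≥ 1/10`). [cite: Tao2016AveragedNS, §5.5 (toke)] -/
theorem Es_decay (hX : ∀ t, HasDerivAt X (delayCircuitWith K M ε (X t)) t) (h0 : X 0 = delayInit)
    (hε : 0 < ε) (hε1 : ε ≤ 1) (hM0 : 0 < M) (hMK : M ≤ K ^ 10) (hK : 16 ≤ K) (hεK : ε ^ 2 ≤ 1 / (6 * K ^ 20))
    (hε100 : ε ≤ 1 / K ^ 100)
    (hεexp : ε ^ 2 ≤ exp (-(18 * M)) / (64 * M)) (hδ : 0 ≤ δ) (hon : K ^ 110 ≤ exp (M * δ / 8))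
    (hτ1 : 1 ≤ τ) (hfit : τ + δ + (sqrt K)⁻¹ ≤ 2)
    (hcτ : ∀ t, 0 ≤ t → t ≤ τ → X t 2 ≤ ε ^ 2 / K ^ 10) (hcτeq : X τ 2 = ε ^ 2 / K ^ 10)
    {t : ℝ} (ht : t ∈ Icc (τ + δ + 1 / sqrt K) 2) :
    (1 - X t 4 * X t 4) / 2 - K / 2 * (X t 0 * X t 3 * (ε ^ 2 * (X t 2)⁻¹) * X t 4)
      ≤ exp ((1 - sqrt K) / 10) + 70 / K ^ 90 := by
  have hK0 : 0 < K := by linarith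
  have hK1 : 1 ≤ K := by linarith
  obtain ⟨hs0, hs4, hKs, h4, hKs2⟩ := invSqrt_facts hK
  have hτ2 : τ ≤ 2 := by linarith
  have hu0' : 0 < K⁻¹ := inv_pos.2 hK0
  have he₀ : 1 / 10 ≤ X (τ + δ + K⁻¹) 4 := e_tenth hX h0 hε hε1 hM0 hMK hK hεK hεexp hδ hon hτ1 hfit hcτ hcτeq
  have he₀pos : 0 < X (τ + δ + K⁻¹) 4 := lt_of_lt_of_le (by norm_num) he₀
  have hKe : 0 < K * X (τ + δ + K⁻¹) 4 := mul_pos hK0 he₀pos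
  have hKinv : K⁻¹ ≤ (sqrt K)⁻¹ := by
    rw [inv_le_inv₀ hK0 (by positivity)]
    calc sqrt K ≤ sqrt K * sqrt K := le_mul_of_one_le_right (by positivity) (by linarith)
      _ = K := mul_self_sqrt hK0.le
  have ht't : τ + δ + K⁻¹ ≤ t := by rw [one_div] at ht; linarith [ht.1]
  have hI : ∀ s ∈ Icc (τ + δ + K⁻¹) 2, s ∈ Icc (τ + δ) 2 := fun s hs =>
    ⟨by linarith [hs.1], hs.2⟩
  have hC0 : 0 ≤ 7 / K ^ 89 / (K * X (τ + δ + K⁻¹) 4) := by positivity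
  -- Grönwall in integrating-factor form
  have hanti := antitoneOn_intFactor (s := Icc (τ + δ + K⁻¹) 2)
    (f := fun s => (1 - X s 4 * X s 4) / 2 - K / 2 * (X s 0 * X s 3 * (ε ^ 2 * (X s 2)⁻¹) * X s 4))
    (g := fun _ => -(K * X (τ + δ + K⁻¹) 4)) (G := fun s => -(K * X (τ + δ + K⁻¹) 4 * s))
    (φ := fun s => 7 / K ^ 89 * exp (K * X (τ + δ + K⁻¹) 4 * s))
    (Φ := fun s => 7 / K ^ 89 / (K * X (τ + δ + K⁻¹) 4) * exp (K * X (τ + δ + K⁻¹) 4 * s))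
    (convex_Icc _ 2)
    (fun s hs => by
      have hsI := hI s hs
      have hcl : K ^ 100 * ε ^ 2 ≤ X s 2 :=
        c_large hX h0 hε hε1 hM0 hMK hK hεK hεexp hδ hon hτ1 hτ2 hcτ hcτeq hsI
      have hcne : X s 2 ≠ 0 := (lt_of_lt_of_le (by positivity) hcl).ne'
      exact hasDerivAt_Es hX hε.ne' hcne)
    (fun s _ => ((hasDerivAt_id s).const_mul (K * X (τ + δ + K⁻¹) 4)).neg.congr_deriv (by simp))
    (fun s _ => by
      have hne : K * X (τ + δ + K⁻¹) 4 ≠ 0 := hKe.ne'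
      have := (((hasDerivAt_id s).const_mul (K * X (τ + δ + K⁻¹) 4)).exp).const_mul
        (7 / K ^ 89 / (K * X (τ + δ + K⁻¹) 4))
      refine this.congr_deriv ?_
      simp only [mul_one, id_eq]
      generalize X (τ + δ + K⁻¹) 4 = e₀ at hne ⊢
      have hne' : e₀ ≠ 0 := right_ne_zero_of_mul hne
      field_simp)
    (fun s hs => by
      have hdis := Es_dissipation hX h0 hε hε1 hM0 hMK hK hεK hε100 hεexp hδ hon hτ1 hfit hcτ hcτeq hs
      have hE : exp (-(-(K * X (τ + δ + K⁻¹) 4 * s))) = exp (K * X (τ + δ + K⁻¹) 4 * s) := by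
        rw [neg_neg]
      rw [hE]
      have h2 := mul_le_mul_of_nonneg_right hdis (exp_pos (K * X (τ + δ + K⁻¹) 4 * s)).le
      linarith)
  have ht'mem : τ + δ + K⁻¹ ∈ Icc (τ + δ + K⁻¹) 2 :=
    ⟨le_rfl, by linarith⟩
  have htmem : t ∈ Icc (τ + δ + K⁻¹) 2 := ⟨ht't, ht.2⟩
  have hA := hanti ht'mem htmem ht't
  simp only [neg_neg] at hA
  have hsplit : exp (K * X (τ + δ + K⁻¹) 4 * (τ + δ + K⁻¹))
      = exp (K * X (τ + δ + K⁻¹) 4 * t) * exp (K * X (τ + δ + K⁻¹) 4 * ((τ + δ + K⁻¹) - t)) := by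
    rw [← exp_add]; congr 1; ring
  rw [hsplit] at hA
  -- `E_*(t') ≤ 1`
  have hEs1 : (1 - X (τ + δ + K⁻¹) 4 * X (τ + δ + K⁻¹) 4) / 2
      - K / 2 * (X (τ + δ + K⁻¹) 0 * X (τ + δ + K⁻¹) 3 * (ε ^ 2 * (X (τ + δ + K⁻¹) 2)⁻¹) * X (τ + δ + K⁻¹) 4)
      ≤ 1 := by
    have h1 : (1 - X (τ + δ + K⁻¹) 4 * X (τ + δ + K⁻¹) 4) / 2 ≤ 1 / 2 := by
      nlinarith [mul_self_nonneg (X (τ + δ + K⁻¹) 4)]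
    have h2 := (abs_le.1 (KVe_small hX h0 hε hε1 hM0 hMK hK hεK hεexp hδ hon hτ1 hτ2 hcτ hcτeq
      (hI _ ht'mem))).1
    have h3 : 1 / 2 / K ^ 99 ≤ 1 / 2 := by
      rw [div_le_iff₀ (by positivity)]
      have : (1 : ℝ) ≤ K ^ 99 := one_le_pow₀ hK1
      linarith
    linarith
  have hρ0 : 0 < exp (K * X (τ + δ + K⁻¹) 4 * ((τ + δ + K⁻¹) - t)) := exp_pos _
  have hEst := decay_alg (exp_pos _) hρ0 hC0 hEs1 hA
  -- `ρ ≤ exp((1 - √K)/10)`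
  have hρle : exp (K * X (τ + δ + K⁻¹) 4 * ((τ + δ + K⁻¹) - t)) ≤ exp ((1 - sqrt K) / 10) := by
    rw [exp_le_exp]
    have h1 : K * X (τ + δ + K⁻¹) 4 * ((τ + δ + K⁻¹) - t) ≤ K * (1 / 10) * ((τ + δ + K⁻¹) - t) := by
      have hn : (τ + δ + K⁻¹) - t ≤ 0 := by linarith
      have := mul_le_mul_of_nonpos_right (mul_le_mul_of_nonneg_left he₀ hK0.le) hn
      linarith
    have h2 : K * (1 / 10) * ((τ + δ + K⁻¹) - t) ≤ K * (1 / 10) * (K⁻¹ - (sqrt K)⁻¹) := by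
      refine mul_le_mul_of_nonneg_left ?_ (by positivity)
      rw [one_div] at ht; linarith [ht.1]
    have h3 : K * (1 / 10) * (K⁻¹ - (sqrt K)⁻¹) = (1 - sqrt K) / 10 := by
      have : K * (sqrt K)⁻¹ = sqrt K := hKs
      have hKK : K * K⁻¹ = 1 := mul_inv_cancel₀ hK0.ne'
      calc K * (1 / 10) * (K⁻¹ - (sqrt K)⁻¹) = (K * K⁻¹ - K * (sqrt K)⁻¹) / 10 := by ring
        _ = (1 - sqrt K) / 10 := by rw [this, hKK]
    linarith
  have hCle : 7 / K ^ 89 / (K * X (τ + δ + K⁻¹) 4) ≤ 70 / K ^ 90 := by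
    rw [div_le_div_iff₀ hKe (by positivity)]
    calc 7 / K ^ 89 * K ^ 90 = 7 * K := by field_simp
      _ = 70 * (K * (1 / 10)) := by ring
      _ ≤ 70 * (K * X (τ + δ + K⁻¹) 4) := by
          have := mul_le_mul_of_nonneg_left he₀ hK0.le
          linarith
  linarith

/-- **(toke) ⇒ (beable), core estimate**: on `[σ + 1/√K, 2]`, `a² + d² ≤ 142K⁻²⁰`
(`a² + d² = 2E_* + KVã - b² - c²`). [cite: Tao2016AveragedNS, §5.5 (beable)] -/
theorem ad_small_late (hX : ∀ t, HasDerivAt X (delayCircuitWith K M ε (X t)) t) (h0 : X 0 = delayInit)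
    (hε : 0 < ε) (hε1 : ε ≤ 1) (hM0 : 0 < M) (hMK : M ≤ K ^ 10) (hK : 16 ≤ K) (hεK : ε ^ 2 ≤ 1 / (6 * K ^ 20))
    (hε100 : ε ≤ 1 / K ^ 100)
    (hεexp : ε ^ 2 ≤ exp (-(18 * M)) / (64 * M)) (hδ : 0 ≤ δ) (hon : K ^ 110 ≤ exp (M * δ / 8))
    (hN4 : 2 * exp ((1 - sqrt K) / 10) ≤ 1 / K ^ 20)
    (hτ1 : 1 ≤ τ) (hfit : τ + δ + (sqrt K)⁻¹ ≤ 2)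
    (hcτ : ∀ t, 0 ≤ t → t ≤ τ → X t 2 ≤ ε ^ 2 / K ^ 10) (hcτeq : X τ 2 = ε ^ 2 / K ^ 10)
    {t : ℝ} (ht : t ∈ Icc (τ + δ + 1 / sqrt K) 2) : X t 0 ^ 2 + X t 3 ^ 2 ≤ 142 / K ^ 20 := by
  have hK0 : 0 < K := by linarith
  have hK1 : 1 ≤ K := by linarith
  obtain ⟨hs0, hs4, hKs, h4, hKs2⟩ := invSqrt_facts hK
  have hτ2 : τ ≤ 2 := by linarith
  have htI : t ∈ Icc (τ + δ) 2 := ⟨by rw [one_div] at ht; linarith [ht.1], ht.2⟩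
  have hEs := Es_decay hX h0 hε hε1 hM0 hMK hK hεK hε100 hεexp hδ hon hτ1 hfit hcτ hcτeq ht
  have hVt := (abs_le.1 (KVe_small hX h0 hε hε1 hM0 hMK hK hεK hεexp hδ hon hτ1 hτ2 hcτ hcτeq htI)).2
  have hsum := traj_sum_sq_eq_one hX h0 t
  have h99 : 1 / 2 / K ^ 99 ≤ 1 / 2 / K ^ 20 := by
    apply div_le_div_of_nonneg_left (by norm_num) (by positivity)
    exact pow_le_pow_right₀ hK1 (by norm_num)
  have h90 : 70 / K ^ 90 ≤ 70 / K ^ 20 := by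
    apply div_le_div_of_nonneg_left (by norm_num) (by positivity)
    exact pow_le_pow_right₀ hK1 (by norm_num)
  have hexp20 : exp ((1 - sqrt K) / 10) ≤ 1 / 2 / K ^ 20 := by
    have h := hN4
    rw [div_div, le_div_iff₀ (by positivity)]
    rw [le_div_iff₀ (by positivity)] at h
    linarith
  -- express everything in the single atom `w = (K²⁰)⁻¹`
  have hw1 : (1 : ℝ) / 2 / K ^ 20 = 1 / 2 * (K ^ 20)⁻¹ := by ring
  have hw2 : (70 : ℝ) / K ^ 20 = 70 * (K ^ 20)⁻¹ := by ring
  have hw3 : (142 : ℝ) / K ^ 20 = 142 * (K ^ 20)⁻¹ := by ring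
  rw [hw3]
  rw [hw1] at hexp20 h99
  rw [hw2] at h90
  have hee : X t 4 * X t 4 = X t 4 ^ 2 := by ring
  linarith [sq_nonneg (X t 1), sq_nonneg (X t 2)]

/-- **(beable), squared form**: for `t ≥ t_c + 1/√K`, `a² + b² + c² + d² ≤ 143K⁻²⁰` (on `[·,2]` from
`ad_small_late` and `b, c = O(ε)`; for `t ≥ 2` by monotonicity of `ã` and (energy-con)).
[cite: Tao2016AveragedNS, §5.5 (beable)] -/
theorem late_sum_sq (hX : ∀ t, HasDerivAt X (delayCircuitWith K M ε (X t)) t) (h0 : X 0 = delayInit)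
    (hε : 0 < ε) (hε1 : ε ≤ 1) (hM0 : 0 < M) (hMK : M ≤ K ^ 10) (hK : 16 ≤ K) (hεK : ε ^ 2 ≤ 1 / (6 * K ^ 20))
    (hε100 : ε ≤ 1 / K ^ 100)
    (hεexp : ε ^ 2 ≤ exp (-(18 * M)) / (64 * M)) (hδ : 0 ≤ δ) (hon : K ^ 110 ≤ exp (M * δ / 8))
    (hN4 : 2 * exp ((1 - sqrt K) / 10) ≤ 1 / K ^ 20)
    (hτ1 : 1 ≤ τ) (hfit : τ + δ + (sqrt K)⁻¹ ≤ 2)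
    (hcτ : ∀ t, 0 ≤ t → t ≤ τ → X t 2 ≤ ε ^ 2 / K ^ 10) (hcτeq : X τ 2 = ε ^ 2 / K ^ 10)
    {t : ℝ} (ht : τ + δ + 1 / sqrt K ≤ t) :
    X t 0 ^ 2 + X t 1 ^ 2 + X t 2 ^ 2 + X t 3 ^ 2 ≤ 143 / K ^ 20 := by
  have hK0 : 0 < K := by linarith
  have hK1 : 1 ≤ K := by linarith
  obtain ⟨hs0, hs4, hKs, h4, hKs2⟩ := invSqrt_facts hK
  -- `b² + c² ≤ K⁻²⁰` on `[0,2]`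
  have hbc : ∀ s ∈ Icc (0 : ℝ) 2, X s 1 ^ 2 + X s 2 ^ 2 ≤ 1 / K ^ 20 := by
    intro s hs
    obtain ⟨hb5, hc5⟩ := bc_small hX h0 hε hε1 hM0.le hs
    have hb2 : X s 1 ^ 2 ≤ (5 * ε) ^ 2 := by
      rw [← sq_abs]; exact pow_le_pow_left₀ (abs_nonneg _) hb5 2
    have hc2 : X s 2 ^ 2 ≤ (5 * ε) ^ 2 := by
      rw [← sq_abs]; exact pow_le_pow_left₀ (abs_nonneg _) hc5 2
    have hεε : ε ^ 2 ≤ ε := by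
      calc ε ^ 2 = ε * ε := sq ε
        _ ≤ ε * 1 := mul_le_mul_of_nonneg_left hε1 hε.le
        _ = ε := mul_one ε
    have h50 : 50 * (1 / K ^ 100) ≤ 1 / K ^ 20 := by
      rw [mul_one_div, div_le_div_iff₀ (by positivity) (by positivity), one_mul]
      have h80 : (50 : ℝ) ≤ K ^ 80 := by
        have : (16 : ℝ) ^ 80 ≤ K ^ 80 := pow_le_pow_left₀ (by norm_num) hK 80
        linarith
      calc (50 : ℝ) * K ^ 20 ≤ K ^ 80 * K ^ 20 := mul_le_mul_of_nonneg_right h80 (by positivity)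
        _ = K ^ 100 := by ring
    have : (5 * ε) ^ 2 = 25 * ε ^ 2 := by ring
    linarith [hεε.trans hε100]
  have hle2 : ∀ s, τ + δ + 1 / sqrt K ≤ s → s ≤ 2 →
      X s 0 ^ 2 + X s 1 ^ 2 + X s 2 ^ 2 + X s 3 ^ 2 ≤ 143 / K ^ 20 := by
    intro s hs1 hs2
    have had := ad_small_late hX h0 hε hε1 hM0 hMK hK hεK hε100 hεexp hδ hon hN4 hτ1 hfit hcτ hcτeq
      ⟨hs1, hs2⟩
    have hs0 : 0 ≤ s := by rw [one_div] at hs1; linarith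
    have := hbc s ⟨hs0, hs2⟩
    have : 142 / K ^ 20 + 1 / K ^ 20 = 143 / K ^ 20 := by ring
    linarith
  by_cases h2 : t ≤ 2
  · exact hle2 t ht h2
  · -- `t > 2`: monotonicity of `ã` from time `2`
    have h2' : 2 < t := not_le.1 h2
    have hτs : τ + δ + 1 / sqrt K ≤ 2 := by rw [one_div]; linarith
    have hS2 := hle2 2 hτs le_rfl
    have hsum2 := traj_sum_sq_eq_one hX h0 2
    have hsumt := traj_sum_sq_eq_one hX h0 t
    have hmonoE := delayCircuitWith_output_monotone hK0.le hX
    have he2t : X 2 4 ≤ X t 4 := hmonoE h2'.le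
    have he20 : 0 ≤ X 2 4 := e_nonneg hX h0 hK0.le (by norm_num)
    have hsq : X 2 4 ^ 2 ≤ X t 4 ^ 2 := pow_le_pow_left₀ he20 he2t 2
    linarith

/-- From `∑_{i≠4} Xᵢ² ≤ 143K⁻²⁰` and (energy-con): all of (beable) with constant `200`.
[cite: Tao2016AveragedNS, §5.5 (beable)] -/
theorem beable_of_sum_sq (hX : ∀ t, HasDerivAt X (delayCircuitWith K M ε (X t)) t)
    (h0 : X 0 = delayInit) (hK : 16 ≤ K) {t : ℝ} (ht0 : 0 ≤ t)
    (hS : X t 0 ^ 2 + X t 1 ^ 2 + X t 2 ^ 2 + X t 3 ^ 2 ≤ 143 / K ^ 20) :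
    |X t 4 - 1| ≤ 200 / K ^ 10 ∧ ∀ i : Fin 5, i ≠ 4 → |X t i| ≤ 200 / K ^ 10 := by
  have hK0 : 0 < K := by linarith
  have hK1 : 1 ≤ K := by linarith
  have hsum := traj_sum_sq_eq_one hX h0 t
  have he0 : 0 ≤ X t 4 := e_nonneg hX h0 hK0.le ht0
  have he1 : X t 4 ≤ 1 := (le_abs_self _).trans (traj_abs_le_one hX h0 t 4)
  have h2010 : 143 / K ^ 20 ≤ 143 / K ^ 10 := by
    apply div_le_div_of_nonneg_left (by norm_num) (by positivity)
    exact pow_le_pow_right₀ hK1 (by norm_num)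
  have h143 : 143 / K ^ 10 ≤ 200 / K ^ 10 :=
    div_le_div_of_nonneg_right (by norm_num) (by positivity)
  have hsq : ∀ x : ℝ, x ^ 2 ≤ 143 / K ^ 20 → |x| ≤ 200 / K ^ 10 := by
    intro x hx
    have hx' : x ^ 2 ≤ (12 / K ^ 10) ^ 2 := by
      rw [div_pow, show (K ^ 10) ^ 2 = K ^ 20 by ring]
      exact hx.trans (div_le_div_of_nonneg_right (by norm_num) (by positivity))
    calc |x| ≤ sqrt ((12 / K ^ 10) ^ 2) := abs_le_sqrt hx'
      _ = 12 / K ^ 10 := sqrt_sq (by positivity)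
      _ ≤ 200 / K ^ 10 := div_le_div_of_nonneg_right (by norm_num) (by positivity)
  have hx0 : X t 0 ^ 2 ≤ 143 / K ^ 20 := by
    nlinarith [sq_nonneg (X t 1), sq_nonneg (X t 2), sq_nonneg (X t 3)]
  have hx1 : X t 1 ^ 2 ≤ 143 / K ^ 20 := by
    nlinarith [sq_nonneg (X t 0), sq_nonneg (X t 2), sq_nonneg (X t 3)]
  have hx2 : X t 2 ^ 2 ≤ 143 / K ^ 20 := by
    nlinarith [sq_nonneg (X t 0), sq_nonneg (X t 1), sq_nonneg (X t 3)]
  have hx3 : X t 3 ^ 2 ≤ 143 / K ^ 20 := by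
    nlinarith [sq_nonneg (X t 0), sq_nonneg (X t 1), sq_nonneg (X t 2)]
  have ha := hsq _ hx0
  have hb := hsq _ hx1
  have hc := hsq _ hx2
  have hd := hsq _ hx3
  refine ⟨?_, ?_⟩
  · rw [abs_sub_comm, abs_of_nonneg (by linarith)]
    have : 1 - X t 4 ≤ 1 - X t 4 ^ 2 := by nlinarith
    linarith
  · intro i hi
    fin_cases i
    · exact ha
    · exact hb
    · exact hc
    · exact hd
    · exact absurd rfl hi

/-- (able2) with constant `200`: on `[0, t_c]`. [cite: Tao2016AveragedNS, §5.5 (able2)] -/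
theorem able_window (hX : ∀ t, HasDerivAt X (delayCircuitWith K M ε (X t)) t) (h0 : X 0 = delayInit)
    (hε : 0 < ε) (hε1 : ε ≤ 1) (hM0 : 0 ≤ M) (hK : 16 ≤ K) (hεK : ε ^ 2 ≤ 1 / (6 * K ^ 20))
    (hε100 : ε ≤ 1 / K ^ 100) (hτ2 : τ ≤ 2)
    (hcτ : ∀ t, 0 ≤ t → t ≤ τ → X t 2 ≤ ε ^ 2 / K ^ 10)
    {t : ℝ} (ht : t ∈ Icc 0 τ) :
    |X t 0 - 1| ≤ 200 / K ^ 10 ∧ ∀ i : Fin 5, i ≠ 0 → |X t i| ≤ 200 / K ^ 10 := by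
  have hK0 : 0 < K := by linarith
  have hK1 : 1 ≤ K := by linarith
  have ht2 : t ∈ Icc (0 : ℝ) 2 := ⟨ht.1, ht.2.trans hτ2⟩
  have ha := a_near_one hX h0 hε hε1 hM0 hK0 hτ2 hεK hcτ ht
  obtain ⟨hb, hc⟩ := bc_small hX h0 hε hε1 hM0 ht2
  obtain ⟨hd, he⟩ := de_small hX h0 hε hK0 hτ2 hcτ ht
  have h20 : 8 / K ^ 20 ≤ 200 / K ^ 10 := by
    calc 8 / K ^ 20 ≤ 8 / K ^ 10 := by
          apply div_le_div_of_nonneg_left (by norm_num) (by positivity)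
          exact pow_le_pow_right₀ hK1 (by norm_num)
      _ ≤ 200 / K ^ 10 := div_le_div_of_nonneg_right (by norm_num) (by positivity)
  have h5 : 5 * ε ≤ 200 / K ^ 10 := by
    have h1 : 1 / K ^ 100 ≤ 1 / K ^ 10 := by
      apply div_le_div_of_nonneg_left (by norm_num) (by positivity)
      exact pow_le_pow_right₀ hK1 (by norm_num)
    have h2 : 5 * (1 / K ^ 10) ≤ 200 / K ^ 10 := by
      rw [mul_one_div]; exact div_le_div_of_nonneg_right (by norm_num) (by positivity)
    linarith
  have h3 : 3 / K ^ 10 ≤ 200 / K ^ 10 := div_le_div_of_nonneg_right (by norm_num) (by positivity)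
  have hb' := hb.trans h5
  have hc' := hc.trans h5
  have hd' := hd.trans h3
  have he' := he.trans h3
  refine ⟨ha.trans h20, ?_⟩
  intro i hi
  fin_cases i
  · exact absurd rfl hi
  · exact hb'
  · exact hc'
  · exact hd'
  · exact he'

end Decay

section Assembly

/-! ## Assembly of Theorem 5.3 for the family -/

/-- Numerical facts about `ε ≤ ε₁ := exp(-10M)/K¹⁰⁰` for `K ≥ 16`, `0 < M ≤ K¹⁰`.
[cite: Tao2016AveragedNS, Theorem 5.3 ("if `ε` is sufficiently small depending on `K`")] -/
theorem eps_facts {K M ε : ℝ} (hK : 16 ≤ K) (hM0 : 0 < M) (hMK : M ≤ K ^ 10) (hε : 0 < ε)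
    (hεle : ε ≤ exp (-(10 * M)) / K ^ 100) :
    ε ≤ 1 ∧ ε ^ 2 ≤ 1 / (6 * K ^ 20) ∧ ε ≤ 1 / K ^ 100 ∧
      ε ^ 2 ≤ exp (-(18 * M)) / (64 * M) := by
  have hK0 : 0 < K := by linarith
  have hK1 : 1 ≤ K := by linarith
  have hexp1 : exp (-(10 * M)) ≤ 1 := by
    rw [exp_le_one_iff, neg_nonpos]; positivity
  have h100 : ε ≤ 1 / K ^ 100 :=
    hεle.trans (div_le_div_of_nonneg_right hexp1 (by positivity))
  have hK100 : (1 : ℝ) ≤ K ^ 100 := one_le_pow₀ hK1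
  have h1 : ε ≤ 1 := h100.trans (by rw [div_le_iff₀ (by positivity)]; linarith)
  have hsq : ε ^ 2 ≤ (exp (-(10 * M)) / K ^ 100) ^ 2 := pow_le_pow_left₀ hε.le hεle 2
  refine ⟨h1, ?_, h100, ?_⟩
  · have h2 : ε ^ 2 ≤ (1 / K ^ 100) ^ 2 := pow_le_pow_left₀ hε.le h100 2
    refine h2.trans ?_
    rw [div_pow, one_pow, div_le_div_iff₀ (by positivity) (by positivity), one_mul, one_mul]
    calc 6 * K ^ 20 ≤ K ^ 180 * K ^ 20 := by
          have : (6 : ℝ) ≤ K ^ 180 := by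
            have : (16 : ℝ) ^ 180 ≤ K ^ 180 := pow_le_pow_left₀ (by norm_num) hK 180
            linarith
          exact mul_le_mul_of_nonneg_right this (by positivity)
      _ = (K ^ 100) ^ 2 := by ring
  · refine hsq.trans ?_
    rw [div_pow, div_le_div_iff₀ (by positivity) (by positivity)]
    have he : exp (-(10 * M)) ^ 2 ≤ exp (-(18 * M)) := by
      rw [← exp_nat_mul, exp_le_exp]; push_cast; nlinarith
    have hp : 64 * M ≤ (K ^ 100) ^ 2 := by
      calc 64 * M ≤ 64 * K ^ 10 := by linarith
        _ ≤ K ^ 190 * K ^ 10 := by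
            have : (64 : ℝ) ≤ K ^ 190 := by
              have : (16 : ℝ) ^ 190 ≤ K ^ 190 := pow_le_pow_left₀ (by norm_num) hK 190
              linarith
            exact mul_le_mul_of_nonneg_right this (by positivity)
        _ = (K ^ 100) ^ 2 := by ring
    exact mul_le_mul he hp (by positivity) (exp_pos _).le

/-- **Parameter bookkeeping for the family.** For `K ≥ K₀ = 2·20⁴²·42! + 16` and
`3000 log K ≤ M ≤ K¹⁰`: `K ≥ 16`, `M > 0`, `48 log K ≤ M`, the numeric input (N4)
`2e^{(1-√K)/10} ≤ K⁻²⁰`, and for the onset delay `δ = 880 log K / M`: `δ ≥ 0`,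
`e^{Mδ/8} = K¹¹⁰` (so (c-large) applies from `t_c + δ` on), `δ ≤ 880/3000`, `2/M ≤ 1/3000`.
[cite: Tao2016AveragedNS, §5.5 ("if `K` is sufficiently large")] -/
theorem family_params {K M : ℝ} (hK : 2 * 20 ^ 42 * (Nat.factorial 42 : ℝ) + 16 ≤ K)
    (hML : 3000 * Real.log K ≤ M) :
    16 ≤ K ∧ 0 < M ∧ 48 * Real.log K ≤ M ∧ 2 ≤ Real.log K ∧
    2 * exp ((1 - sqrt K) / 10) ≤ 1 / K ^ 20 ∧
    0 ≤ 880 * Real.log K / M ∧ K ^ 110 ≤ exp (M * (880 * Real.log K / M) / 8) ∧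
    880 * Real.log K / M ≤ 880 / 3000 ∧ 2 / M ≤ 1 / 3000 := by
  have hB : (0 : ℝ) ≤ 2 * 20 ^ 42 * (Nat.factorial 42 : ℝ) := by positivity
  have hK16 : 16 ≤ K := by linarith
  have hK0 : 0 < K := by linarith
  have hlog2 : 2 ≤ Real.log K := (log_facts hK16).1
  have hM0 : 0 < M := by nlinarith
  have hN4 : 2 * exp ((1 - sqrt K) / 10) ≤ 1 / K ^ 20 := numeric_N4 hK16 (by linarith)
  have hδ0 : 0 ≤ 880 * Real.log K / M := div_nonneg (by nlinarith) hM0.le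
  have hexp : M * (880 * Real.log K / M) / 8 = (110 : ℕ) * Real.log K := by
    push_cast; field_simp; ring
  have hon : K ^ 110 ≤ exp (M * (880 * Real.log K / M) / 8) := by
    rw [hexp, Real.exp_nat_mul, Real.exp_log hK0]
  have hLM : Real.log K / M ≤ 1 / 3000 := by
    rw [div_le_div_iff₀ hM0 (by norm_num)]; linarith
  have hδle : 880 * Real.log K / M ≤ 880 / 3000 := by
    rw [mul_div_assoc]; linarith
  have h2M : 2 / M ≤ 1 / 3000 := by
    rw [div_le_div_iff₀ hM0 (by norm_num)]; nlinarith
  exact ⟨hK16, hM0, by nlinarith, hlog2, hN4, hδ0, hon, hδle, h2M⟩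

/-- The second window fits inside `[0,2]`: from `τ² ≤ 2 + 2/M ≤ 2 + 1/3000` (`τ ≤ 1.415`),
`δ ≤ 880/3000` and `1/√K ≤ 1/4`: `τ + δ + 1/√K ≤ 2`.
[cite: Tao2016AveragedNS, §5.5 ("for `K` large enough")] -/
theorem window_fits {K M τ δ : ℝ} (hK : 16 ≤ K) (hτ1 : 1 ≤ τ) (hhi : τ ^ 2 ≤ 2 + 2 / M)
    (h2M : 2 / M ≤ 1 / 3000) (hδ : δ ≤ 880 / 3000) : τ + δ + (sqrt K)⁻¹ ≤ 2 := by
  obtain ⟨hs0, hs4, hKs, h4, hKs2⟩ := invSqrt_facts hK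
  have hτ : τ ≤ 1415 / 1000 := by nlinarith
  linarith

end Assembly

end Thm53With

/-! ## Theorem 5.3 for the family -/

/-- **Theorem 5.3 for the retuned family `delayCircuitWith K M ε`, uniformly in the amplifier
rate `3000·log K ≤ M ≤ K¹⁰`** (a NAMED FACT, discharged below; `M = K¹⁰` is Tao's circuit by
`delayCircuitWith_pow_ten`). Same shape as `DelayedAbruptTransition` with the `M`-dependent
time-scales made explicit: the critical time is `t_c = √2 + O(log K / M)`, the first window is
ALL of `[0, t_c]`, and the second window opens at `t_c + C·log K/M + 1/√K` (onset delay
`880 log K / M` of the rotor + the `1/√K` equipartition time); levels `O(K⁻¹⁰)` as in Tao;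
`ε ≤ ε₁(K,M) = e^{-10M}/K¹⁰⁰`. Framing: low prior, high value-of-information experiment on Tao's
machine paradigm; NOT a claim that NS blows up. [cite: Tao2016AveragedNS, Theorem 5.3, §5.5] -/
def DelayedAbruptTransitionWith : Prop :=
  ∃ C : ℝ, 0 < C ∧ ∃ K₀ : ℝ, 0 < K₀ ∧ ∀ K : ℝ, K₀ ≤ K → ∀ M : ℝ, C * Real.log K ≤ M → M ≤ K ^ 10 →
    ∃ ε₁ : ℝ, 0 < ε₁ ∧ ∀ ε : ℝ, 0 < ε → ε ≤ ε₁ → ∀ X : ℝ → Fin 5 → ℝ, X 0 = delayInit →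
      (∀ t, HasDerivAt X (delayCircuitWith K M ε (X t)) t) →
      ∃ tc : ℝ, |tc - Real.sqrt 2| ≤ C * Real.log K / M ∧
        (∀ t ∈ Set.Icc 0 tc,
          |X t 0 - 1| ≤ C / K ^ 10 ∧ ∀ i : Fin 5, i ≠ 0 → |X t i| ≤ C / K ^ 10) ∧
        (∀ t, tc + C * Real.log K / M + 1 / Real.sqrt K ≤ t →
          |X t 4 - 1| ≤ C / K ^ 10 ∧ ∀ i : Fin 5, i ≠ 4 → |X t i| ≤ C / K ^ 10)

/-- **Theorem 5.3 for the family with explicit constants**: for `K ≥ K₀ = 2·20⁴²·42! + 16`,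
`3000 log K ≤ M ≤ K¹⁰`, `0 < ε ≤ e^{-10M}/K¹⁰⁰` and every trajectory of `delayCircuitWith K M ε` from
`delayInit`: a critical time with `|t_c - √2| ≤ 24 log K / M`, the quiet window ALL of `[0, t_c]` at
level `200K⁻¹⁰`, the fired window from `t_c + 880 log K / M + 1/√K` on at level `200K⁻¹⁰`.
[cite: Tao2016AveragedNS, Theorem 5.3, §5.5] -/
theorem transitionWith_explicit {K M ε : ℝ} {X : ℝ → Fin 5 → ℝ}
    (hK : 2 * 20 ^ 42 * (Nat.factorial 42 : ℝ) + 16 ≤ K) (hML : 3000 * Real.log K ≤ M)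
    (hMK : M ≤ K ^ 10) (hε : 0 < ε) (hεle : ε ≤ exp (-(10 * M)) / K ^ 100)
    (h0 : X 0 = delayInit) (hX : ∀ t, HasDerivAt X (delayCircuitWith K M ε (X t)) t) :
    ∃ tc : ℝ, |tc - Real.sqrt 2| ≤ 24 * Real.log K / M ∧
      (∀ t ∈ Set.Icc 0 tc,
        |X t 0 - 1| ≤ 200 / K ^ 10 ∧ ∀ i : Fin 5, i ≠ 0 → |X t i| ≤ 200 / K ^ 10) ∧
      (∀ t, tc + 880 * Real.log K / M + 1 / Real.sqrt K ≤ t →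
        |X t 4 - 1| ≤ 200 / K ^ 10 ∧ ∀ i : Fin 5, i ≠ 4 → |X t i| ≤ 200 / K ^ 10) := by
  obtain ⟨hK16, hM0, hML48, hlog2, hN4, hδ, hon, hδle, h2M⟩ :=
    Thm53With.family_params hK hML
  have hK0 : 0 < K := by linarith
  obtain ⟨hε1, hεK, hε100, hεexp⟩ := Thm53With.eps_facts hK16 hM0 hMK hε hεle
  -- the critical time: first hitting time of the level `K⁻¹⁰ε²` by `c` on `[0,2]`
  obtain ⟨τ, hτ0, hτ2, hcτ, hτeq⟩ := Thm53.exists_hitTime (Thm53With.continuous_traj hX 2)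
    (θ := ε ^ 2 / K ^ 10) (T := 2) two_pos (by rw [Thm53.init_c h0]; positivity)
  obtain ⟨hlo, hhi, hτ1, hτ32, hcτeq⟩ :=
    Thm53With.tc_window hX h0 hε hε1 hM0 hMK hK16 hML48 hεK hτ0 hτ2 hcτ hτeq
  have hfit : τ + 880 * Real.log K / M + (sqrt K)⁻¹ ≤ 2 :=
    Thm53With.window_fits hK16 hτ1 hhi h2M hδle
  refine ⟨τ, Thm53With.abs_sub_sqrt_two_le hτ1 (div_nonneg (by linarith) hM0.le)
      (div_le_div_of_nonneg_right (by linarith) hM0.le) hlo hhi, ?_, ?_⟩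
  · -- (able), on all of `[0, t_c]`
    intro t ht
    exact Thm53With.able_window hX h0 hε hε1 hM0.le hK16 hεK hε100 hτ2 hcτ ht
  · -- (beable)
    intro t ht
    have ht0 : 0 ≤ t := by
      have : 0 < (sqrt K)⁻¹ := (Thm53.invSqrt_facts hK16).1
      rw [one_div] at ht; linarith
    exact Thm53With.beable_of_sum_sq hX h0 hK16 ht0
      (Thm53With.late_sum_sq hX h0 hε hε1 hM0 hMK hK16 hεK hε100 hεexp hδ hon hN4 hτ1 hfit
        hcτ hcτeq ht)

/-- **Theorem 5.3 holds for the family**, with `C = 3000`, `K₀ = 2·20⁴²·42! + 16`,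
`ε₁(K,M) = e^{-10M}/K¹⁰⁰`, `t_c` = the first time `c` reaches `K⁻¹⁰ε²`.
[cite: Tao2016AveragedNS, Theorem 5.3] -/
theorem delayedAbruptTransitionWith_holds : DelayedAbruptTransitionWith := by
  have hB : (0 : ℝ) ≤ 2 * 20 ^ 42 * (Nat.factorial 42 : ℝ) := by positivity
  refine ⟨3000, by norm_num, 2 * 20 ^ 42 * (Nat.factorial 42 : ℝ) + 16, by linarith, ?_⟩
  intro K hK M hML hMK
  obtain ⟨hK16, hM0, -, hlog2, -⟩ := Thm53With.family_params hK hML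
  have hK0 : 0 < K := by linarith
  refine ⟨exp (-(10 * M)) / K ^ 100, by positivity, ?_⟩
  intro ε hε hεle X h0 hX
  obtain ⟨tc, htc, hearly, hlate⟩ := transitionWith_explicit hK hML hMK hε hεle h0 hX
  have hC10 : (200 : ℝ) / K ^ 10 ≤ 3000 / K ^ 10 :=
    div_le_div_of_nonneg_right (by norm_num) (by positivity)
  have hLM0 : 0 ≤ Real.log K / M := div_nonneg (by linarith) hM0.le
  refine ⟨tc, ?_, ?_, ?_⟩
  · refine htc.trans ?_
    rw [mul_div_assoc, mul_div_assoc]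
    nlinarith
  · intro t ht
    obtain ⟨ha, hi⟩ := hearly t ht
    exact ⟨ha.trans hC10, fun i hi0 => (hi i hi0).trans hC10⟩
  · intro t ht
    have hδC : 880 * Real.log K / M ≤ 3000 * Real.log K / M := by
      rw [mul_div_assoc, mul_div_assoc]; nlinarith
    obtain ⟨he, hi⟩ := hlate t (by linarith)
    exact ⟨he.trans hC10, fun i hi0 => (hi i hi0).trans hC10⟩

/-- The seed coupling of the member `M = p·log K` is POLYNOMIAL: `e^{-p log K} = K⁻ᵖ`. [folklore] -/
theorem exp_neg_natMul_log {K : ℝ} (hK : 0 < K) (p : ℕ) :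
    Real.exp (-(p * Real.log K)) = (K ^ p)⁻¹ := by
  rw [Real.exp_neg, ← Real.log_pow, Real.exp_log (pow_pos hK p)]

/-- The member `M = p log K` of the family is (5.5) with the POLYNOMIAL seed `ε²K⁻ᵖ : a → c` and the
amplifier `ε⁻¹ p log K : b ⇒ c`. [cite: Tao2016AveragedNS, §5.5 (5.5)] -/
theorem delayCircuitWith_log {K : ℝ} (hK : 0 < K) (p : ℕ) (ε : ℝ) (X : Fin 5 → ℝ) :
    delayCircuitWith K (p * Real.log K) ε X =
      ![-((ε ^ 2)⁻¹ * X 2 * X 3) - ε * X 0 * X 1 - ε ^ 2 * (K ^ p)⁻¹ * X 0 * X 2,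
        ε * X 0 ^ 2 - ε⁻¹ * (p * Real.log K) * X 2 ^ 2,
        ε ^ 2 * (K ^ p)⁻¹ * X 0 ^ 2 + ε⁻¹ * (p * Real.log K) * X 1 * X 2,
        (ε ^ 2)⁻¹ * X 2 * X 0 - K * X 3 * X 4,
        K * X 3 ^ 2] := by
  simp only [delayCircuitWith, exp_neg_natMul_log hK]

/-- **A polynomially small seed suffices (Theorem 5.3 for `M = p log K`).** For `p ≥ 3000`,
`K ≥ K₀ = 2·20⁴²·42! + 16` with `p ≤ K⁹`, and `0 < ε ≤ K^{-(10p + 100)}`: every trajectory of the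
circuit with seed `ε²K⁻ᵖ` and amplifier `ε⁻¹p log K` from `delayInit` is quiet (`a = 1 + O(K⁻¹⁰)`,
rest `O(K⁻¹⁰)`) on `[0, t_c]` with `|t_c - √2| ≤ 24/p`, and has fired (`ã = 1 + O(K⁻¹⁰)`, rest
`O(K⁻¹⁰)`) for all `t ≥ t_c + 880/p + 1/√K`. Every threshold here is a POWER of `K`.
[cite: Tao2016AveragedNS, Theorem 5.3, §5.5] -/
theorem polySeedTransition {K ε : ℝ} {p : ℕ} {X : ℝ → Fin 5 → ℝ}
    (hK : 2 * 20 ^ 42 * (Nat.factorial 42 : ℝ) + 16 ≤ K) (hp : (3000 : ℝ) ≤ p)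
    (hpK : (p : ℝ) ≤ K ^ 9) (hε : 0 < ε) (hεle : ε ≤ 1 / K ^ (10 * p + 100))
    (h0 : X 0 = delayInit)
    (hX : ∀ t, HasDerivAt X (delayCircuitWith K (p * Real.log K) ε (X t)) t) :
    ∃ tc : ℝ, |tc - Real.sqrt 2| ≤ 24 / p ∧
      (∀ t ∈ Set.Icc 0 tc,
        |X t 0 - 1| ≤ 200 / K ^ 10 ∧ ∀ i : Fin 5, i ≠ 0 → |X t i| ≤ 200 / K ^ 10) ∧
      (∀ t, tc + 880 / p + 1 / Real.sqrt K ≤ t →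
        |X t 4 - 1| ≤ 200 / K ^ 10 ∧ ∀ i : Fin 5, i ≠ 4 → |X t i| ≤ 200 / K ^ 10) := by
  have hB : (0 : ℝ) ≤ 2 * 20 ^ 42 * (Nat.factorial 42 : ℝ) := by positivity
  have hK16 : 16 ≤ K := by linarith
  have hK0 : 0 < K := by linarith
  have hK1 : 1 ≤ K := by linarith
  obtain ⟨hlog2, -, hlog0⟩ := Thm53With.log_facts hK16
  have hp0 : (0 : ℝ) < p := by linarith
  have hlogK : Real.log K ≤ K := (Real.log_le_sub_one_of_pos hK0).trans (by linarith)
  -- admissibility of `M = p log K`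
  have hML : 3000 * Real.log K ≤ p * Real.log K := mul_le_mul_of_nonneg_right hp hlog0.le
  have hMK : p * Real.log K ≤ K ^ 10 := by
    calc (p : ℝ) * Real.log K ≤ K ^ 9 * K := mul_le_mul hpK hlogK hlog0.le (by positivity)
      _ = K ^ 10 := by ring
  -- the ε-threshold is a power of K: `e^{-10 p log K}/K¹⁰⁰ = K^{-(10p+100)}`
  have hεeq : exp (-(10 * (p * Real.log K))) / K ^ 100 = 1 / K ^ (10 * p + 100) := by
    have : (10 : ℝ) * (p * Real.log K) = ((10 * p : ℕ) : ℝ) * Real.log K := by push_cast; ring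
    rw [this, exp_neg_natMul_log hK0, pow_add]
    field_simp
  have hεle' : ε ≤ exp (-(10 * (p * Real.log K))) / K ^ 100 := by rw [hεeq]; exact hεle
  obtain ⟨tc, htc, hearly, hlate⟩ := transitionWith_explicit hK hML hMK hε hεle' h0 hX
  have h24 : 24 * Real.log K / (p * Real.log K) = 24 / p := by
    field_simp
  have h880 : 880 * Real.log K / (p * Real.log K) = 880 / p := by
    field_simp
  refine ⟨tc, by rw [← h24]; exact htc, hearly, fun t ht => hlate t (by rw [h880]; exact ht)⟩

/-- **The internal time-scales of the family's transition** (the `M`-explicit version of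
`delaySolution_internal_timescales`), for every global trajectory of `delayCircuitWith K M ε`
from `delayInit`, `K ≥ K₀`, `3000 log K ≤ M ≤ K¹⁰`, `0 < ε ≤ e^{-10M}/K¹⁰⁰`: a critical time
`t_c` with `|t_c - √2| ≤ 24 log K / M`, `1 ≤ t_c ≤ 3/2`; (boots)/(c-bound) `c ≤ K⁻¹⁰ε²` on
`[0,t_c]` with equality at `t_c`; (c-large) `c ≥ K¹⁰⁰ε²` on `[t_c + 880 log K/M, 2]` (rotor
onset delay `880 log K / M` — for `M = K¹⁰` this is `≤ K⁻⁹`, Tao's); (atc)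
`ã(t_c + 880 log K/M + 1/K) ≥ 1/10`; and from `t_c + 880 log K/M + 1/√K` on the non-output energy
is `≤ 143K⁻²⁰`. These are the SPEC-SHEET quantities (trigger level `K⁻¹⁰ε²`, onset, transfer
mid-point, abruptness `1/√K`) of `SpecDictionary.lean`, now as functions of `(K, M)`.
[cite: Tao2016AveragedNS, §5.5 ((boots), (c-bound), (c-large), (atc), (beable))] -/
theorem internalTimescalesWith {K M ε : ℝ} {X : ℝ → Fin 5 → ℝ}
    (hK : 2 * 20 ^ 42 * (Nat.factorial 42 : ℝ) + 16 ≤ K) (hML : 3000 * Real.log K ≤ M)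
    (hMK : M ≤ K ^ 10) (hε : 0 < ε) (hεle : ε ≤ exp (-(10 * M)) / K ^ 100)
    (h0 : X 0 = delayInit) (hX : ∀ t, HasDerivAt X (delayCircuitWith K M ε (X t)) t) :
    ∃ tc : ℝ, |tc - Real.sqrt 2| ≤ 24 * Real.log K / M ∧ 1 ≤ tc ∧ tc ≤ 3 / 2 ∧
      (∀ t ∈ Set.Icc 0 tc, X t 2 ≤ ε ^ 2 / K ^ 10) ∧ X tc 2 = ε ^ 2 / K ^ 10 ∧
      (∀ t ∈ Set.Icc (tc + 880 * Real.log K / M) 2, K ^ 100 * ε ^ 2 ≤ X t 2) ∧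
      1 / 10 ≤ X (tc + 880 * Real.log K / M + 1 / K) 4 ∧
      (∀ t, tc + 880 * Real.log K / M + 1 / Real.sqrt K ≤ t →
        X t 0 ^ 2 + X t 1 ^ 2 + X t 2 ^ 2 + X t 3 ^ 2 ≤ 143 / K ^ 20) := by
  obtain ⟨hK16, hM0, hML48, hlog2, hN4, hδ, hon, hδle, h2M⟩ :=
    Thm53With.family_params hK hML
  have hK0 : 0 < K := by linarith
  obtain ⟨hε1, hεK, hε100, hεexp⟩ := Thm53With.eps_facts hK16 hM0 hMK hε hεle
  obtain ⟨τ, hτ0, hτ2, hcτ, hτeq⟩ := Thm53.exists_hitTime (Thm53With.continuous_traj hX 2)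
    (θ := ε ^ 2 / K ^ 10) (T := 2) two_pos (by rw [Thm53.init_c h0]; positivity)
  obtain ⟨hlo, hhi, hτ1, hτ32, hcτeq⟩ :=
    Thm53With.tc_window hX h0 hε hε1 hM0 hMK hK16 hML48 hεK hτ0 hτ2 hcτ hτeq
  have hfit : τ + 880 * Real.log K / M + (sqrt K)⁻¹ ≤ 2 :=
    Thm53With.window_fits hK16 hτ1 hhi h2M hδle
  refine ⟨τ, Thm53With.abs_sub_sqrt_two_le hτ1 (div_nonneg (by linarith) hM0.le)
      (div_le_div_of_nonneg_right (by linarith) hM0.le) hlo hhi, hτ1, hτ32,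
    fun t ht => hcτ t ht.1 ht.2, hcτeq, ?_, ?_, ?_⟩
  · intro t ht
    exact Thm53With.c_large hX h0 hε hε1 hM0 hMK hK16 hεK hεexp hδ hon hτ1 hτ2 hcτ hcτeq ht
  · rw [one_div K]
    exact Thm53With.e_tenth hX h0 hε hε1 hM0 hMK hK16 hεK hεexp hδ hon hτ1 hfit hcτ hcτeq
  · intro t ht
    exact Thm53With.late_sum_sq hX h0 hε hε1 hM0 hMK hK16 hεK hε100 hεexp hδ hon hN4 hτ1 hfit
      hcτ hcτeq ht

/-- **Consistency with Tao's member.** The family theorem at `M = K¹⁰` re-proves the named fact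
`DelayedAbruptTransition` of `DelayCircuit.lean` (constant doubled, `K₀` enlarged to absorb `C`;
`t_c` shifted by the onset delay `C log K / K¹⁰ ≤ 1/√K`). Independent second proof of
`DelayedAbruptTransition_holds`. [cite: Tao2016AveragedNS, Theorem 5.3] -/
theorem delayedAbruptTransition_of_with (h : DelayedAbruptTransitionWith) :
    DelayedAbruptTransition := by
  obtain ⟨C, hC, K₀, hK₀, hfam⟩ := h
  refine ⟨2 * C, by positivity, max K₀ (C + 16), lt_max_of_lt_left hK₀, ?_⟩
  intro K hK
  have hKK₀ : K₀ ≤ K := (le_max_left _ _).trans hK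
  have hKC : C + 16 ≤ K := (le_max_right _ _).trans hK
  have hK16 : 16 ≤ K := by linarith
  have hK0 : 0 < K := by linarith
  have hK1 : 1 ≤ K := by linarith
  have hCK : C ≤ K := by linarith
  have hlogK : Real.log K ≤ K := (Real.log_le_sub_one_of_pos hK0).trans (by linarith)
  have hlog0 : 0 ≤ Real.log K := Real.log_nonneg hK1
  obtain ⟨hs0', hs4, hKs, h4, hKs2⟩ := Thm53.invSqrt_facts hK16
  have hsqK : sqrt K ≤ K := by nlinarith [Real.mul_self_sqrt hK0.le]
  have hspos : 0 < sqrt K := by positivity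
  have hK3 : K ^ 3 ≤ K ^ 10 := pow_le_pow_right₀ hK1 (by norm_num)
  -- `M = K¹⁰` is an admissible sharpness once `K ≥ C + 16`
  have hM : C * Real.log K ≤ K ^ 10 := by
    calc C * Real.log K ≤ K * K := mul_le_mul hCK hlogK hlog0 hK0.le
      _ ≤ K ^ 3 := by nlinarith
      _ ≤ K ^ 10 := hK3
  obtain ⟨ε₁, hε₁, hε⟩ := hfam K hKK₀ (K ^ 10) hM le_rfl
  refine ⟨ε₁, hε₁, fun ε hε0 hεle X h0 hX => ?_⟩
  have hX' : ∀ t, HasDerivAt X (delayCircuitWith K (K ^ 10) ε (X t)) t := fun t => by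
    rw [delayCircuitWith_pow_ten]; exact hX t
  obtain ⟨tc, htc, hearly, hlate⟩ := hε ε hε0 hεle X h0 hX'
  -- the onset delay `s = C log K / K¹⁰ ≤ min (1/√K, C/√K)`
  have hs0 : 0 ≤ C * Real.log K / K ^ 10 := div_nonneg (mul_nonneg hC.le hlog0) (by positivity)
  have hs1 : C * Real.log K / K ^ 10 ≤ 1 / sqrt K := by
    rw [div_le_div_iff₀ (by positivity) hspos, one_mul]
    calc C * Real.log K * sqrt K ≤ K * K * K :=
          mul_le_mul (mul_le_mul hCK hlogK hlog0 hK0.le) hsqK (sqrt_nonneg _) (by positivity)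
      _ = K ^ 3 := by ring
      _ ≤ K ^ 10 := hK3
  have hsC : C * Real.log K / K ^ 10 ≤ C / sqrt K := by
    rw [div_le_div_iff₀ (by positivity) hspos]
    have h1 : Real.log K * sqrt K ≤ K ^ 10 := by
      calc Real.log K * sqrt K ≤ K * K := mul_le_mul hlogK hsqK (sqrt_nonneg _) hK0.le
        _ ≤ K ^ 3 := by nlinarith
        _ ≤ K ^ 10 := hK3
    calc C * Real.log K * sqrt K = C * (Real.log K * sqrt K) := by ring
      _ ≤ C * K ^ 10 := mul_le_mul_of_nonneg_left h1 hC.le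
  have hC2 : C / K ^ 10 ≤ 2 * C / K ^ 10 := div_le_div_of_nonneg_right (by linarith) (by positivity)
  refine ⟨tc + C * Real.log K / K ^ 10, ?_, ?_, ?_⟩
  · -- `|t_c + s - √2| ≤ |t_c - √2| + s ≤ 2s ≤ 2C/√K`
    have h1 : |tc + C * Real.log K / K ^ 10 - sqrt 2| ≤ |tc - sqrt 2| + C * Real.log K / K ^ 10 := by
      rw [show tc + C * Real.log K / K ^ 10 - sqrt 2
          = (tc - sqrt 2) + C * Real.log K / K ^ 10 by ring]
      exact (abs_add_le _ _).trans (by rw [abs_of_nonneg hs0])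
    have h2 : 2 * C / sqrt K = C / sqrt K + C / sqrt K := by ring
    rw [h2]
    linarith
  · -- first window `[0, t_c + s - 1/√K] ⊆ [0, t_c]`
    intro t ht
    have ht' : t ∈ Set.Icc 0 tc := ⟨ht.1, by linarith [ht.2]⟩
    obtain ⟨ha, hi⟩ := hearly t ht'
    exact ⟨ha.trans hC2, fun i hi0 => (hi i hi0).trans hC2⟩
  · -- second window: the thresholds coincide
    intro t ht
    obtain ⟨he, hi⟩ := hlate t ht
    exact ⟨he.trans hC2, fun i hi0 => (hi i hi0).trans hC2⟩

end Literature.Analysis.FluidPDE.Tao2016AveragedNS
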